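/-
# critic_g43_junction.lean — stub-critic g43 certificate for `stub_heegnerIndexLowerAtTwo`
(crux item stmt-BirchSwinnertonDyer-27851 = `PrintCf2.SplitBadTwoLowerHalfOfFacts`; rows 122–124 of
CRITIC-ROWS-g43.md; STUB-PLAN v7.6).  BSD is NOT proved here; nothing below touches the skeleton.

PART A  = card k2-g42's sketch body VERBATIM (namespace re-rooted under `CriticG43`), plus k2-g40's
          strengthened fact `thmII414_exists_lMeasure_cosetValues` + projection VERBATIM (PART A′).
PART B  = card k3-g42's sketch §1–§6 VERBATIM (namespace re-rooted; §7 = the consumer re-keying is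
          certified separately by the card's own file, rc 0 / axioms standard, see CRITIC-ROWS-g43 row 122).
PART C  = the critic's junction theorems J19–J24 (all kernel-closed, no `sorry`):
  J19  `lMeasureFactWith_cosetValues_of_fact`  : k2-g40's fact A′ ⟹ k3's cut PIECE 1 with `Extra := IsCosetValues`
  J19′ `forall_lMeasureFactWith_cosetValues_iff`: (∀-closed PIECE 1 at `IsCosetValues`) ↔ A′  (`Iff.rfl`)
  J20  `lMeasureFactWith_true_iff` / `thmII414_iff_forall_lMeasureFactWith_true` : PIECE 1 at `Extra := ⊤`
        is de Shalit II.4.14 (`DeShalit1987.thmII414_exists_lMeasure`) instance-wise / globally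
  J21  the «Extra dial»: `lMeasureFactWith_mono`, `measureValue_anti`, `measureValue_mono_right`
  J22  `KatzValueUpper₂` := k1-g40's one-sided `hRle` binder text VERBATIM as a named Prop, and
        `katzValueUpper₂_of_cut` : PIECE 1 ∧ PIECE 2 ∧ PIECE 3(‖·‖ ≤ 2^(−M/2)) ⟹ `KatzValueUpper₂`
        (= k3's `katzValueExists_of_cut` at the inequality) + `measureValue_le_of_eq`
  J23  `cosetValueIdentity_on_cut_witness` : from PIECE 1 at `IsCosetValues` and `v, v̄ ∉ S`, the
        fact's OWN witness `μ` carries k2-g42's `CosetValueIdentity` at every admissible key (A′ end-to-end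
        on one witness: the LOWER receptacle `MeasureValue … IsCosetValues …` may assume these identities)
  J24  `measureValue_of_forall_cosetValueIdentity` : the producer's interface — to deliver PIECE 3 at
        `Extra := IsCosetValues` it suffices to bound `‖∫ r·l dμ‖` for every L-measure witness carrying the
        coset values (definitional unfolding, recorded so that R197a″/R200′(b″) start from a typed goal).
-/
import Literature.NumberTheory.EllipticCurves.DeShalit1987.LMeasureExistence
import Literature.NumberTheory.EllipticCurves.DeShalit1987.RayClassTower
import Literature.NumberTheory.ComplexMultiplication.EllipticUnits.ThetaSingularValues
import Literature.NumberTheory.ComplexMultiplication.EllipticUnits.RingOfIntegersPeriodLattice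
import Literature.NumberTheory.ComplexMultiplication.EllipticUnits.RubinEulerSystem
import Literature.NumberTheory.LocalFields.PadicComplexLog
import Literature.NumberTheory.GaloisRepresentations.IntegralGaloisActionProofs
import Literature.NumberTheory.GaloisRepresentations.ArtinReciprocityCharacterFiniteProofs
import Literature.NumberTheory.GaloisRepresentations.GlobalArtinMapOfCharactersProofs
import Literature.NumberTheory.GaloisRepresentations.CyclotomicFrobenius
import HarnessLib

set_option linter.dupNamespace false

noncomputable section

/-! # PART A — k2-g42 `CosetInstancesK2G42` VERBATIM (defs §0, §1–§7) -/

namespace Summit.BirchSwinnertonDyer.BirchSwinnertonDyer.Cruxes.SplitBadTwoLowerHalfOfFacts.CriticG43.CosetInstancesK2G42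

open scoped Classical
open NumberField IsDedekindDomain Field Complex
open Literature.NumberTheory.GaloisRepresentations
open Literature.NumberTheory.EllipticCurves
open Literature.NumberTheory.ComplexMultiplication.EllipticUnits
open Literature.NumberTheory.NumberFields (rayClassField isUnramifiedIn_rayClassField)
open Literature.NumberTheory.LFunctions.AbelianDensity (artinSymbol artinSymbol_finsuppProd)
open Literature.NumberTheory.LocalFields (PadicComplex.iwasawaLog)

variable {p : ℕ} [Fact p.Prime] {K : Type} [Field K] [NumberField K]

/-! ## §0 The node definitions of record (k2-g40 `CosetValuesK2G40`, VERBATIM; one copy at port P51) -/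

/-- `ι⁻¹ z ∈ ℂ_p` for a unit `z ∈ ℂˣ` (values of finite-order characters). -/
def cval (ι : PadicAlgCl p ≃+* ℂ) (z : ℂˣ) : ℂ_[p] :=
  ((ι.symm ((z : ℂˣ) : ℂ) : PadicAlgCl p) : ℂ_[p])

/-- The `p`-adic embedding `j_p = ι⁻¹ ∘ ι̂ : K̄ → ℂ → ℂ_p` attached to `ιK : K → ℂ`. -/
def pEmb (ι : PadicAlgCl p ≃+* ℂ) (ιK : K →+* ℂ) (x : AlgebraicClosure K) : ℂ_[p] :=
  ((ι.symm (algClosureEmb ιK x) : PadicAlgCl p) : ℂ_[p])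

/-- The Galois group `Gal(K(𝔤)/K)` of the ray class field (finite abelian). -/
abbrev RayGal (K : Type) [Field K] [NumberField K] (𝔤 : Ideal (𝓞 K)) : Type :=
  rayClassField K 𝔤 ≃ₐ[K] rayClassField K 𝔤

/-- The integrand `ρ = χ̂⁻¹ : Γ_K → ℂ_p` of a character `χ` of `Gal(K(𝔤)/K)`. -/
def galCharInv (ι : PadicAlgCl p ≃+* ℂ) (𝔤 : Ideal (𝓞 K)) (χ : RayGal K 𝔤 →* ℂˣ) :
    absoluteGaloisGroup K → ℂ_[p] :=
  fun σ ↦ cval ι (χ (absRestrictNormalHom (rayClassField K 𝔤) σ))⁻¹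

/-- The Gauss sum `G(χ⁻¹)` — de Shalit II.4.11 (30) ≡ 4.8 (19), `γ₀`-coset form. -/
def gaussSumInv (ι : PadicAlgCl p ≃+* ℂ) (ιK : K →+* ℂ) (𝔤 : Ideal (𝓞 K)) (n : ℕ)
    (χ : RayGal K 𝔤 →* ℂˣ) (γ₀ : absoluteGaloisGroup K) (ζ : AlgebraicClosure K)
    (α : (ZMod (p ^ n))ˣ → 𝓞 K) : ℂ_[p] :=
  ((p : ℂ_[p]) ^ n)⁻¹ * cval ι (χ (absRestrictNormalHom (rayClassField K 𝔤) γ₀))⁻¹ *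
    ∑ a : (ZMod (p ^ n))ˣ,
      cval ι (χ (artinSymbol (galFrob K (rayClassField K 𝔤)) (Ideal.span {α a})))⁻¹ *
        ((pEmb ι ιK (γ₀ • ζ)) ^ (a : ZMod (p ^ n)).val)⁻¹

/-- `Σ_{g ∈ Gal(K(𝔤)/K)} ι⁻¹χ(g) · Log j_p(g u)` — the elliptic-unit side of II.5.2 (4). -/
def unitLogSum (ι : PadicAlgCl p ≃+* ℂ) (ιK : K →+* ℂ) (𝔤 : Ideal (𝓞 K))
    (χ : RayGal K 𝔤 →* ℂˣ) (u : rayClassField K 𝔤) : ℂ_[p] :=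
  ∑ g : RayGal K 𝔤,
    cval ι (χ g) * PadicComplex.iwasawaLog p (pEmb ι ιK ((g u : rayClassField K 𝔤) : AlgebraicClosure K))

/-- One table entry: de Shalit II.5.2 (4) at exact `𝔭`-level `n ≥ 1`. -/
def CosetValueIdentity (ι : PadicAlgCl p ≃+* ℂ) (ιK : K →+* ℂ) (𝔤 : Ideal (𝓞 K)) (n : ℕ)
    (𝔞 : Ideal (𝓞 K)) (χ : RayGal K 𝔤 →* ℂˣ) (u : rayClassField K 𝔤)
    (γ₀ : absoluteGaloisGroup K) (ζ : AlgebraicClosure K) (α : (ZMod (p ^ n))ˣ → 𝓞 K)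
    {𝒰 : SubgroupTower (absoluteGaloisGroup K)} (μ : GroupDistribution 𝒰 ℂ_[p]) : Prop :=
  12 * (cval ι (χ (artinSymbol (galFrob K (rayClassField K 𝔤)) 𝔞))⁻¹ - (Ideal.absNorm 𝔞 : ℂ_[p])) *
      μ.integral (galCharInv ι 𝔤 χ) =
    gaussSumInv ι ιK 𝔤 n χ γ₀ ζ α * unitLogSum ι ιK 𝔤 χ u

/-- **A′ = «(KLF-COSET)₂», the conjunct** (k2-g40's text of record, verbatim). -/
def IsCosetValues (ι : PadicAlgCl p ≃+* ℂ) (v vbar : HeightOneSpectrum (𝓞 K))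
    (S : Finset (HeightOneSpectrum (𝓞 K))) (𝒰 : SubgroupTower (absoluteGaloisGroup K))
    (μ : GroupDistribution 𝒰 ℂ_[p]) : Prop :=
  ∀ (ιK : K →+* ℂ), (∀ k : 𝓞 K, k ∈ v.asIdeal ↔ ‖ι.symm (ιK (k : K))‖ < 1) →
  ∀ (𝔣 : Ideal (𝓞 K)) (n : ℕ), 1 ≤ n → 𝔣 ≠ ⊥ → IsCoprime 𝔣 v.asIdeal →
    (∀ w : HeightOneSpectrum (𝓞 K), w.asIdeal ∣ 𝔣 ↔ (w ∈ S ∨ w = vbar)) →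
    rootsOfUnityCongruentOne 𝔣 = 1 →
  ∀ (𝔞 : Ideal (𝓞 K)), IsCoprime 𝔞 (Ideal.span {(6 : 𝓞 K)} * (𝔣 * v.asIdeal ^ n)) →
  ∀ (L La : PeriodPair) (T : Finset ℂ),
    (∀ z : ℂ, z ∈ L.lattice ↔ ∃ a ∈ 𝔣 * v.asIdeal ^ n, z = ιK (a : K)) →
    La.lattice = idealInvLattice ιK 𝔞 L.lattice → L.IsLatticeReps La T →
  ∀ (u : rayClassField K (𝔣 * v.asIdeal ^ n)),
    algClosureEmb ιK (u : AlgebraicClosure K) = L.deShalitTheta La T 1 →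
  ∀ (χ : RayGal K (𝔣 * v.asIdeal ^ n) →* ℂˣ),
    (∃ δ ∈ relGalSet K (𝔣 * v.asIdeal ^ n) (𝔣 * v.asIdeal ^ (n - 1)), χ δ ≠ 1) →
    𝒰.IsTowerContinuous (galCharInv ι (𝔣 * v.asIdeal ^ n) χ) →
  ∀ (ζ : AlgebraicClosure K),
    algClosureEmb ιK ζ = Complex.exp (2 * Real.pi * Complex.I / (p : ℂ) ^ n) →
  ∀ (γ₀ : absoluteGaloisGroup K),
    (∀ m : ℕ, absRestrictNormalHom (rayClassField K (𝔣 * vbar.asIdeal ^ m)) γ₀ =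
      artinSymbol (galFrob K (rayClassField K (𝔣 * vbar.asIdeal ^ m))) (v.asIdeal ^ n)) →
  ∀ (α : (ZMod (p ^ n))ˣ → 𝓞 K),
    (∀ a, α a - 1 ∈ 𝔣 ∧ α a - ((a : ZMod (p ^ n)).val : 𝓞 K) ∈ v.asIdeal ^ n) →
  CosetValueIdentity ι ιK (𝔣 * v.asIdeal ^ n) n 𝔞 χ u γ₀ ζ α μ

/-! ## §1 H2 (R223-H): `rayKer K p S ≤ ker(Γ_K → Gal(K(𝔤)/K))` for `supp 𝔤 ⊆ S ∪ {v, v̄}` -/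

omit [Fact p.Prime] in
/-- **H2 = k2-g40 `stubsig_rayKer_le_ker`, PROVED.**  Dictionary: de Shalit's `𝒢 = Gal(K(𝔣p^∞)/K)`
(II.4.12 Remark (i), II.4.16) ↦ `Γ_K ⧸ rayKer K p S`; «`χ` of conductor dividing `𝔤 = 𝔣𝔭ⁿ` is a
character of `𝒢`» ↦ the tree's `DeShalit1987.rayKer_le_ker_absRestrictNormalHom_rayClassField`
(Neukirch VI (6.6): `K(𝔤)` is abelian, unramified at every `w ∤ 𝔤`), specialised to a modulus whose
prime support lies in `S ∪ {v, v̄}`. [cite: deShalit1987, II.4.12 Remark (i) (p. 67)]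
[cite: NeukirchANT1999, Ch. VI §6 Cor. (6.6)] -/
theorem rayKer_le_ker (S : Finset (HeightOneSpectrum (𝓞 K))) (v vbar : HeightOneSpectrum (𝓞 K))
    (hv : ((p : ℕ) : 𝓞 K) ∈ v.asIdeal) (hvbar : ((p : ℕ) : 𝓞 K) ∈ vbar.asIdeal)
    (𝔤 : Ideal (𝓞 K)) (h𝔤 : 𝔤 ≠ ⊥)
    (hsupp : ∀ w : HeightOneSpectrum (𝓞 K), w.asIdeal ∣ 𝔤 → w ∈ S ∨ w = v ∨ w = vbar) :
    DeShalit1987.rayKer K p S ≤ (absRestrictNormalHom (rayClassField K 𝔤)).ker :=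
  DeShalit1987.rayKer_le_ker_absRestrictNormalHom_rayClassField p S h𝔤 fun w hwS hwp hle ↦ by
    rcases hsupp w (Ideal.dvd_iff_le.mpr hle) with h | rfl | rfl
    · exact hwS h
    · exact hwp hv
    · exact hwp hvbar

omit [Fact p.Prime] in
/-- The support clause of `IsCosetValues` (`w ∣ 𝔣 ↔ w ∈ S ∨ w = v̄`) gives the support hypothesis of
H2 for `𝔤 = 𝔣vⁿ`. [cite: deShalit1987, II.5.2 (p. 79)] -/
theorem supp_mul_pow {S : Finset (HeightOneSpectrum (𝓞 K))} {v vbar : HeightOneSpectrum (𝓞 K)}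
    {𝔣 : Ideal (𝓞 K)} (hsupp : ∀ w : HeightOneSpectrum (𝓞 K), w.asIdeal ∣ 𝔣 ↔ (w ∈ S ∨ w = vbar))
    (n : ℕ) (w : HeightOneSpectrum (𝓞 K)) (hw : w.asIdeal ∣ 𝔣 * v.asIdeal ^ n) :
    w ∈ S ∨ w = v ∨ w = vbar := by
  rcases (Ideal.IsPrime.mul_le w.isPrime).mp (Ideal.dvd_iff_le.mp hw) with h | h
  · rcases (hsupp w).mp (Ideal.dvd_iff_le.mpr h) with h' | h'
    · exact Or.inl h'
    · exact Or.inr (Or.inr h')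
  · have hle : v.asIdeal ≤ w.asIdeal := w.isPrime.le_of_pow_le h
    have hmax : v.asIdeal.IsMaximal := v.isPrime.isMaximal v.ne_bot
    exact Or.inr (Or.inl (HeightOneSpectrum.ext (hmax.eq_of_le w.isPrime.ne_top hle)).symm)

/-! ## §2 H2′: the tower-continuity hypothesis of `IsCosetValues` is DISCHARGED on the fact's tower -/

/-- **Tower-continuity of `χ̂⁻¹` along the fact's `𝒰`.**  For the tower of
`thmII414_exists_lMeasure(_cosetValues)` (`U_n` open, `⋂ U_n ⊆ rayKer K p S`) and `supp 𝔤 ⊆ S ∪ {v, v̄}`,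
the integrand `galCharInv ι 𝔤 χ` is tower-continuous: it is CONSTANT on the cosets of the open
subgroup `ker(Γ_K → Gal(K(𝔤)/K)) ⊇ rayKer K p S` (H2), and the tower is cofinal among open sets above
`rayKer` (`SubgroupTower.IsTowerContinuous.of_cofinal`, Cantor).  So the clause's hypothesis
`𝒰.IsTowerContinuous (galCharInv …)` costs the consumer nothing. [cite: deShalit1987, II.4.16 (49) (p. 76), II.5.2 (p. 79)] -/
theorem isTowerContinuous_galCharInv (ι : PadicAlgCl p ≃+* ℂ) {S : Finset (HeightOneSpectrum (𝓞 K))}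
    {v vbar : HeightOneSpectrum (𝓞 K)} (hv : ((p : ℕ) : 𝓞 K) ∈ v.asIdeal)
    (hvbar : ((p : ℕ) : 𝓞 K) ∈ vbar.asIdeal) {𝔤 : Ideal (𝓞 K)} (h𝔤 : 𝔤 ≠ ⊥)
    (hsupp : ∀ w : HeightOneSpectrum (𝓞 K), w.asIdeal ∣ 𝔤 → w ∈ S ∨ w = v ∨ w = vbar)
    (χ : RayGal K 𝔤 →* ℂˣ) {𝒰 : SubgroupTower (absoluteGaloisGroup K)}
    (hU : ∀ n, IsOpen (𝒰.U n : Set (absoluteGaloisGroup K)))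
    (hN : ⋂ n, (𝒰.U n : Set (absoluteGaloisGroup K)) ⊆ DeShalit1987.rayKer K p S) :
    𝒰.IsTowerContinuous (galCharInv ι 𝔤 χ) := by
  refine SubgroupTower.IsTowerContinuous.of_cofinal hU hN fun ε hε ↦
    ⟨((absRestrictNormalHom (rayClassField K 𝔤)).ker : Set (absoluteGaloisGroup K)),
      isOpen_ker_absRestrictNormalHom _, fun ν hν ↦ rayKer_le_ker S v vbar hv hvbar 𝔤 h𝔤 hsupp hν,
      fun σ τ hστ ↦ ?_⟩
  have h : absRestrictNormalHom (rayClassField K 𝔤) σ = absRestrictNormalHom (rayClassField K 𝔤) τ := by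
    have h1 : (absRestrictNormalHom (rayClassField K 𝔤)) (σ⁻¹ * τ) = 1 := hστ
    rwa [map_mul, map_inv, inv_mul_eq_one] at h1
  simp only [galCharInv, h, dist_self, hε]

/-! ## §2b (d1) READING: `∫ χ̂⁻¹ dμ` along the fact's tower IS a finite Riemann sum (I.3.1) -/

/-- **(d1), kernel half.**  Row 118 deferred to the typer «that `GroupDistribution.integral` along `𝒰`
of a tower-continuous `χ̂⁻¹` IS `∫_{𝒢(𝔣)} χ⁻¹ dμ(𝔣)`».  On the fact's tower there is a level `N` with
`U_N ⊆ ker(Γ_K → Gal(K(𝔤)/K))` (H2 + cofinality), `χ̂⁻¹` factors through `Γ_K ⧸ U_N`, and the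
`limUnder`-integral EQUALS the level-`N` Riemann sum `Σ_{a ∈ Γ_K/U_N} μ_N(a)·χ⁻¹(repr a|_{K(𝔤)})` —
de Shalit's own definition of integrating a locally constant function (I.3.1 «if `G` is finite
`Λ(G, M) ≃ M[G]`»).  What remains of (d1) is only the Γ_K-presentation of `μ(𝔣)` that `IsLMeasure`
already fixes. [cite: deShalit1987, I.3.1 (p. 16); II.4.16 (49) (p. 76)] -/
theorem exists_integral_galCharInv_eq_sum (ι : PadicAlgCl p ≃+* ℂ)
    {S : Finset (HeightOneSpectrum (𝓞 K))} {v vbar : HeightOneSpectrum (𝓞 K)}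
    (hv : ((p : ℕ) : 𝓞 K) ∈ v.asIdeal) (hvbar : ((p : ℕ) : 𝓞 K) ∈ vbar.asIdeal) {𝔤 : Ideal (𝓞 K)}
    (h𝔤 : 𝔤 ≠ ⊥) (hsupp : ∀ w : HeightOneSpectrum (𝓞 K), w.asIdeal ∣ 𝔤 → w ∈ S ∨ w = v ∨ w = vbar)
    (χ : RayGal K 𝔤 →* ℂˣ) {𝒰 : SubgroupTower (absoluteGaloisGroup K)}
    (hU : ∀ n, IsOpen (𝒰.U n : Set (absoluteGaloisGroup K)))
    (hN : ⋂ n, (𝒰.U n : Set (absoluteGaloisGroup K)) ⊆ DeShalit1987.rayKer K p S)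
    (μ : GroupDistribution 𝒰 ℂ_[p]) :
    ∃ N : ℕ, (𝒰.U N : Set (absoluteGaloisGroup K)) ⊆ (absRestrictNormalHom (rayClassField K 𝔤)).ker ∧
      μ.integral (galCharInv ι 𝔤 χ) =
        ∑ a ∈ 𝒰.cells N, μ.μ N a * galCharInv ι 𝔤 χ (𝒰.repr N a) := by
  obtain ⟨N, hNk⟩ := 𝒰.exists_subset_of_isOpen hU hN (isOpen_ker_absRestrictNormalHom _)
    (fun ν hν ↦ rayKer_le_ker S v vbar hv hvbar 𝔤 h𝔤 hsupp hν)
  refine ⟨N, hNk, μ.integral_eq_sum_of_factorsThrough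
    (fun a ↦ galCharInv ι 𝔤 χ (𝒰.repr N a)) fun x ↦ ?_⟩
  have hmem : (𝒰.repr N (𝒰.proj N x))⁻¹ * x ∈ 𝒰.U N :=
    𝒰.proj_eq_iff.mp (𝒰.proj_repr N _)
  have h1 : absRestrictNormalHom (rayClassField K 𝔤) ((𝒰.repr N (𝒰.proj N x))⁻¹ * x) = 1 := hNk hmem
  rw [map_mul, map_inv, inv_mul_eq_one] at h1
  simp only [galCharInv, h1]

/-! ## §2c (d2): the `κ`-representatives `α_a` are prime to `𝔤 = 𝔣vⁿ` (no junk Artin symbol) -/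

omit [Fact p.Prime] [NumberField K] in
/-- `α_a ∉ v`: `α_a ≡ a (vⁿ)` with `a` a unit mod `pⁿ`, `n ≥ 1`, `p ∈ v`. [folklore] -/
theorem not_mem_of_kappaRep {v : HeightOneSpectrum (𝓞 K)} (hv : ((p : ℕ) : 𝓞 K) ∈ v.asIdeal)
    {n : ℕ} (hn : 1 ≤ n) (a : (ZMod (p ^ n))ˣ) {x : 𝓞 K}
    (hx : x - ((a : ZMod (p ^ n)).val : 𝓞 K) ∈ v.asIdeal ^ n) : x ∉ v.asIdeal := by
  intro hxv
  obtain ⟨s, t, hst⟩ :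
      IsCoprime ((((a : ZMod (p ^ n)).val : ℕ) : 𝓞 K)) (((p ^ n : ℕ) : 𝓞 K)) :=
    (ZMod.val_coe_unit_coprime a).cast
  have ha : (((a : ZMod (p ^ n)).val : ℕ) : 𝓞 K) ∈ v.asIdeal := by
    have := v.asIdeal.sub_mem hxv (Ideal.pow_le_self (by omega : n ≠ 0) hx)
    rwa [sub_sub_cancel] at this
  have hp : ((p ^ n : ℕ) : 𝓞 K) ∈ v.asIdeal := by
    rw [Nat.cast_pow]; exact v.asIdeal.pow_mem_of_mem hv n (by omega)
  have h1 : (1 : 𝓞 K) ∈ v.asIdeal :=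
    hst ▸ v.asIdeal.add_mem (v.asIdeal.mul_mem_left s ha) (v.asIdeal.mul_mem_left t hp)
  exact v.isPrime.ne_top ((Ideal.eq_top_iff_one _).mpr h1)

omit [Fact p.Prime] in
/-- **(d2), kernel half.**  Row 118 deferred «the tree's `artinSymbol` on the principal ideal `(α_a)`
(total function; `α_a` prime to `𝔤` so no junk value is met)»: the clause's `α`-conditions
(`α_a ≡ 1 (𝔣)`, `α_a ≡ a (vⁿ)`) give `((α_a), 𝔣vⁿ) = 1`, so `artinSymbol (galFrob K (K(𝔤))) (α_a)` is a
product of Frobenii at primes UNRAMIFIED in `K(𝔤)` — the genuine Artin symbol `δ_a`.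
[cite: deShalit1987, II.4.11 (30) (p. 65–66)] [cite: NeukirchANT1999, Ch. VI §7 (7.1)] -/
theorem isCoprime_span_kappaRep {v : HeightOneSpectrum (𝓞 K)} (hv : ((p : ℕ) : 𝓞 K) ∈ v.asIdeal)
    {n : ℕ} (hn : 1 ≤ n) {𝔣 : Ideal (𝓞 K)} (a : (ZMod (p ^ n))ˣ) {x : 𝓞 K} (hx1 : x - 1 ∈ 𝔣)
    (hx : x - ((a : ZMod (p ^ n)).val : 𝓞 K) ∈ v.asIdeal ^ n) :
    IsCoprime (Ideal.span {x}) (𝔣 * v.asIdeal ^ n) := by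
  refine IsCoprime.mul_right ?_ (IsCoprime.pow_right ?_)
  · exact Ideal.isCoprime_iff_exists.mpr
      ⟨x, Ideal.mem_span_singleton_self x, 1 - x, by simpa using 𝔣.neg_mem hx1, by ring⟩
  · rw [Ideal.isCoprime_iff_sup_eq]
    have hmax : v.asIdeal.IsMaximal := v.isPrime.isMaximal v.ne_bot
    refine hmax.1.2 _ (lt_of_le_of_ne le_sup_right fun h ↦ not_mem_of_kappaRep hv hn a hx ?_)
    rw [h]; exact le_sup_left (b := v.asIdeal) (Ideal.mem_span_singleton_self x)

/-! ## §3 H1 (R223-H): the lift `γ₀` — a GLOBAL FROBENIUS POWER `Frob_𝔓ⁿ ∈ Γ_K` -/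

/-- `F(𝔭ⁿ) = f(𝔭)ⁿ` for the multiplicative extension `artinSymbol`. [folklore] -/
theorem artinSymbol_asIdeal_pow {G : Type*} [CommGroup G]
    (f : HeightOneSpectrum (𝓞 K) → G) (v : HeightOneSpectrum (𝓞 K)) (n : ℕ) :
    artinSymbol f (v.asIdeal ^ n) = f v ^ n := by
  have h := artinSymbol_finsuppProd f (Finsupp.single v n)
  simp only [Finsupp.prod_single_index, pow_zero] at h
  exact h

/-- **Frobenius restricts to Frobenius** (public form of the tree's private
`HilbertClassFieldMaximal.absRestrictNormalHom_eq_galFrob`): an arithmetic Frobenius `σ ∈ Γ_K` at a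
prime `𝔓` of `ℤ̄_K` above `v` restricts, on every finite ABELIAN `L ⊆ K̄` unramified at `v`, to THE
Frobenius `galFrob K L v`. [cite: NeukirchANT1999, Ch. I §9 (9.5)] [cite: SerreAbelianLadic1968, Ch. I §2.1] -/
theorem absRestrictNormalHom_eq_galFrob (L : IntermediateField K (AlgebraicClosure K))
    [FiniteDimensional K L] [IsAbelianGalois K L] [NumberField L] {v : HeightOneSpectrum (𝓞 K)}
    (hunr : Algebra.IsUnramifiedIn (𝓞 L) v.asIdeal) {𝔓 : Ideal (absIntegers (𝓞 K) K)}
    (h𝔓 : 𝔓 ∈ v.primesAbove) {σ : absoluteGaloisGroup K} (hσ : IsArithFrobAt (𝓞 K) σ 𝔓) :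
    absRestrictNormalHom L σ = galFrob K L v := by
  haveI : 𝔓.IsPrime := h𝔓.1
  exact eq_galFrob (commute_of_isAbelianGalois L) hunr
    (comap_ringOfIntegersToIntegralClosure_mem_primesOver_of_mem_primesAbove _ h𝔓)
    (isArithFrobAt_absRestrictNormalHom _ hσ)

/-- **The universal Frobenius-power lift.**  ONE element `γ₀ = Frob_𝔓ⁿ ∈ Γ_K` (`𝔓` a prime of `ℤ̄_K`
above `v`, `Frob_𝔓` an arithmetic Frobenius — it exists: Serre I §2.1, the tree's
`exists_isArithFrobAt_of_mem_primesAbove_holds`) restricts to the Artin symbol `(vⁿ, K(𝔪)/K)` on the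
ray class field of EVERY modulus `𝔪 ≠ 0` not divisible by `v` — de Shalit's `φ = (𝔭, F′/K)` on
`F′ = K(𝔣𝔭̄^∞)` read as the restriction of a global Frobenius. [cite: deShalit1987, II.4.11 (30) (p. 65–66)]
[cite: SerreAbelianLadic1968, Ch. I §2.1] [cite: NeukirchANT1999, Ch. I §9 Prop. (9.4)] -/
theorem exists_frobPowLift (v : HeightOneSpectrum (𝓞 K)) (n : ℕ) :
    ∃ γ₀ : absoluteGaloisGroup K, ∀ (𝔪 : Ideal (𝓞 K)), 𝔪 ≠ ⊥ → ¬ 𝔪 ≤ v.asIdeal →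
      absRestrictNormalHom (rayClassField K 𝔪) γ₀ =
        artinSymbol (galFrob K (rayClassField K 𝔪)) (v.asIdeal ^ n) := by
  obtain ⟨𝔓, h𝔓⟩ := v.primesAbove_nonempty
  obtain ⟨σ, hσ⟩ := HeightOneSpectrum.exists_isArithFrobAt_of_mem_primesAbove_holds h𝔓
  refine ⟨σ ^ n, fun 𝔪 h𝔪 hv ↦ ?_⟩
  rw [map_pow, artinSymbol_asIdeal_pow,
    absRestrictNormalHom_eq_galFrob _ (isUnramifiedIn_rayClassField h𝔪 hv) h𝔓 hσ]

omit [Fact p.Prime] in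
/-- `v ∤ 𝔣v̄^m` for `𝔣` prime to `v` and `v̄ ≠ v`. [folklore] -/
theorem not_mul_pow_le {𝔣 : Ideal (𝓞 K)} {v vbar : HeightOneSpectrum (𝓞 K)}
    (hv : IsCoprime 𝔣 v.asIdeal) (hne : vbar ≠ v) (m : ℕ) : ¬ 𝔣 * vbar.asIdeal ^ m ≤ v.asIdeal := by
  intro h
  rcases (Ideal.IsPrime.mul_le v.isPrime).mp h with h1 | h1
  · have htop : (⊤ : Ideal (𝓞 K)) ≤ v.asIdeal :=
      (Ideal.isCoprime_iff_sup_eq.mp hv).symm.le.trans (sup_le h1 le_rfl)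
    exact v.isPrime.ne_top (top_le_iff.mp htop)
  · have hle : vbar.asIdeal ≤ v.asIdeal := v.isPrime.le_of_pow_le h1
    have hmax : vbar.asIdeal.IsMaximal := vbar.isPrime.isMaximal vbar.ne_bot
    exact hne (HeightOneSpectrum.ext (hmax.eq_of_le v.isPrime.ne_top hle))

/-- **H1 = k2-g40 `stubsig_exists_frobLift`, PROVED** (signature verbatim): the `γ₀`-binder of
`IsCosetValues` — compatible Artin symbols `(vⁿ, K(𝔣v̄^m)/K)` for ALL `m` — is witnessed by `Frob_𝔓ⁿ`.
[cite: deShalit1987, II.4.11 (30) (p. 65–66)] [cite: SerreAbelianLadic1968, Ch. I §2.1] -/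
theorem exists_frobLift (𝔣 : Ideal (𝓞 K)) (h𝔣 : 𝔣 ≠ ⊥) (v vbar : HeightOneSpectrum (𝓞 K))
    (hv : IsCoprime 𝔣 v.asIdeal) (hne : vbar ≠ v) (n : ℕ) :
    ∃ γ₀ : absoluteGaloisGroup K, ∀ m : ℕ,
      absRestrictNormalHom (rayClassField K (𝔣 * vbar.asIdeal ^ m)) γ₀ =
        artinSymbol (galFrob K (rayClassField K (𝔣 * vbar.asIdeal ^ m))) (v.asIdeal ^ n) := by
  obtain ⟨γ₀, hγ₀⟩ := exists_frobPowLift v n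
  exact ⟨γ₀, fun m ↦ hγ₀ _ (mul_ne_zero h𝔣 (pow_ne_zero m vbar.ne_bot)) (not_mul_pow_le hv hne m)⟩

/-! ## §4 H3 (R223-H): the elliptic unit `e_n(𝔞) = Θ(1; 𝔤, 𝔞) ∈ K(𝔤)`, and the period data -/

omit [Fact p.Prime] in
/-- **H3 = k2-g40 `stubsig_exists_unit`, PROVED** (signature verbatim; XS on the named fact II.2.4 (i)
`DeShalit1987.prop24_i_mem_rayClassField`): `ιK(𝔤)` is a CM lattice (`isCMLattice_of_mem_iff`), `1` is
a primitive `𝔤`-division point of it (`isPrimitiveDivisionPoint_one_of_mem_iff`, Kato (15.3.1)), and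
`(𝔞, 6𝔤) = 1 ⇒ (𝔞, 𝔤) = 1`; then `exists_mem_rayClassField_eq_deShalitTheta`.
[cite: deShalit1987, II.2.4 Proposition (i) (p. 46), II.5.2 (p. 80)] -/
theorem exists_unit (h24 : DeShalit1987.prop24_i_mem_rayClassField)
    (hK : IsImaginaryQuadratic K) (ιK : K →+* ℂ) (𝔤 𝔞 : Ideal (𝓞 K)) (h𝔤 : 𝔤 ≠ ⊥) (h𝔤' : 𝔤 ≠ ⊤)
    (h𝔞 : 𝔞 ≠ ⊥) (hcop : IsCoprime 𝔞 (Ideal.span {(6 : 𝓞 K)} * 𝔤)) (L La : PeriodPair) (T : Finset ℂ)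
    (hL : ∀ z : ℂ, z ∈ L.lattice ↔ ∃ a ∈ 𝔤, z = ιK (a : K))
    (hLa : La.lattice = idealInvLattice ιK 𝔞 L.lattice) (hT : L.IsLatticeReps La T) :
    ∃ u : rayClassField K 𝔤, algClosureEmb ιK (u : AlgebraicClosure K) = L.deShalitTheta La T 1 :=
  exists_mem_rayClassField_eq_deShalitTheta h24 hK ιK (isCMLattice_of_mem_iff hL) h𝔤 h𝔤'
    (isPrimitiveDivisionPoint_one_of_mem_iff hL) h𝔞 hcop.of_mul_right_right hLa hT

omit [Fact p.Prime] in
/-- **The period/unit binders `(L, La, T, u)` of `IsCosetValues` are jointly instantiable**: a period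
pair with lattice `ιK(𝔤)` (`exists_periodPair_mem_iff_ideal`), one with lattice `𝔞⁻¹ιK(𝔤)`
(`exists_periodPair_lattice_eq_idealInvLattice`), representatives `T ∋ 0` of `𝔞⁻¹L/L`
(`PeriodPair.IsLatticeReps.exists`), and the unit (H3). [cite: deShalit1987, II.2.3 (10), II.2.4 (i), II.5.2 (4)] -/
theorem exists_thetaData (h24 : DeShalit1987.prop24_i_mem_rayClassField)
    (hK : IsImaginaryQuadratic K) (ιK : K →+* ℂ) {𝔤 𝔞 : Ideal (𝓞 K)} (h𝔤 : 𝔤 ≠ ⊥) (h𝔤' : 𝔤 ≠ ⊤)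
    (h𝔞 : 𝔞 ≠ ⊥) (hcop : IsCoprime 𝔞 (Ideal.span {(6 : 𝓞 K)} * 𝔤)) :
    ∃ (L La : PeriodPair) (T : Finset ℂ) (u : rayClassField K 𝔤),
      (∀ z : ℂ, z ∈ L.lattice ↔ ∃ a ∈ 𝔤, z = ιK (a : K)) ∧
      La.lattice = idealInvLattice ιK 𝔞 L.lattice ∧ L.IsLatticeReps La T ∧
      algClosureEmb ιK (u : AlgebraicClosure K) = L.deShalitTheta La T 1 := by
  obtain ⟨L, hL⟩ := exists_periodPair_mem_iff_ideal hK ιK h𝔤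
  obtain ⟨La, hLa⟩ := exists_periodPair_lattice_eq_idealInvLattice (isCMLattice_of_mem_iff hL) h𝔞
  have hle : L.lattice ≤ La.lattice := by
    rw [hLa]; exact le_idealInvLattice (isCMLattice_of_mem_iff hL) 𝔞
  obtain ⟨T, hT⟩ := PeriodPair.IsLatticeReps.exists hle
  obtain ⟨u, hu⟩ := exists_unit h24 hK ιK 𝔤 𝔞 h𝔤 h𝔤' h𝔞 hcop L La T hL hLa hT
  exact ⟨L, La, T, u, hL, hLa, hT, hu⟩

/-! ## §5 The orientation binder `ζ` (`ι̂ ζ = e^{2πi/pⁿ}`, II.4.4) is instantiable -/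

omit [NumberField K] in
/-- **An orientation exists in `K̄`**: `e^{2πi/pⁿ}` is a `pⁿ`-th root of `1 = ι̂(1)`, hence `ι̂ ζ` for
some `ζ ∈ K̄` (`exists_algClosureEmb_eq_of_pow_eq`). [cite: deShalit1987, II.4.4 (p. 58)] -/
theorem exists_orientation (ιK : K →+* ℂ) (n : ℕ) :
    ∃ ζ : AlgebraicClosure K,
      algClosureEmb ιK ζ = Complex.exp (2 * Real.pi * Complex.I / (p : ℂ) ^ n) := by
  have hp : (p : ℂ) ^ n ≠ 0 := pow_ne_zero _ (Nat.cast_ne_zero.mpr (Fact.out : p.Prime).ne_zero)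
  refine exists_algClosureEmb_eq_of_pow_eq ιK (pow_pos (Fact.out : p.Prime).pos n) (y := 1) ?_
  have hmul : ((p ^ n : ℕ) : ℂ) * (2 * Real.pi * Complex.I / (p : ℂ) ^ n) = 2 * Real.pi * Complex.I := by
    rw [Nat.cast_pow]; field_simp
  rw [map_one, ← Complex.exp_nat_mul, hmul, Complex.exp_two_pi_mul_I]

/-! ## §6 The CONSUMER FORM: `IsCosetValues` on the fact's witness yields a value identity per key -/

omit [Fact p.Prime] [NumberField K] in
/-- `𝔣vⁿ ≠ 𝒪_K` for `n ≥ 1`. [folklore] -/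
theorem mul_pow_ne_top {𝔣 : Ideal (𝓞 K)} {v : HeightOneSpectrum (𝓞 K)} {n : ℕ} (hn : 1 ≤ n) :
    𝔣 * v.asIdeal ^ n ≠ ⊤ := fun h ↦
  v.isPrime.ne_top (top_le_iff.mp
    (h.symm.le.trans (Ideal.mul_le_left.trans (Ideal.pow_le_self (by omega)))))

/-- **A′ is consumable (every binder witnessed, the analytic hypothesis derived).**  Let `μ` carry
`IsCosetValues ι v vbar S 𝒰 μ` along a tower with `U_n` open and `⋂ U_n ⊆ rayKer K p S` (the clauses of
`thmII414_exists_lMeasure_cosetValues`).  Then for EVERY key — complex embedding `ιK` inducing `v`,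
modulus `𝔣` (`≠ 0`, prime to `v`, support exactly `S ∪ {v̄}`, `w_𝔣 = 1`), level `n ≥ 1`, smoothing
ideal `𝔞 ≠ 0` prime to `6𝔣vⁿ`, character `χ` of exact `v`-level `n` — there EXIST period data
`L, La, T`, the elliptic unit `u = e_n(𝔞) ∈ K(𝔣vⁿ)`, an orientation `ζ`, a Frobenius lift `γ₀` and
`κ`-representatives `α`, all satisfying the clause's side conditions, with de Shalit's identity
II.5.2 (4) `12(χ⁻¹(𝔞) − N𝔞)·∫χ̂⁻¹dμ = G(χ⁻¹)·Σ_g χ(g) log(g·u)` holding for them.  Uses H1, H2′, H3, §5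
and k2-g40's CRT lemma (re-proved inline).  Modulo the one named fact II.2.4 (i).
[cite: deShalit1987, II.5.2 Theorem, proof eq. (4) (p. 80); II.4.11 (30); II.2.4 (i)] -/
theorem exists_cosetValueIdentity (h24 : DeShalit1987.prop24_i_mem_rayClassField)
    (hK : IsImaginaryQuadratic K) {ι : PadicAlgCl p ≃+* ℂ} {v vbar : HeightOneSpectrum (𝓞 K)}
    (hv : ((p : ℕ) : 𝓞 K) ∈ v.asIdeal) (hvbar : ((p : ℕ) : 𝓞 K) ∈ vbar.asIdeal) (hne : vbar ≠ v)
    {S : Finset (HeightOneSpectrum (𝓞 K))} {𝒰 : SubgroupTower (absoluteGaloisGroup K)}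
    {μ : GroupDistribution 𝒰 ℂ_[p]} (hU : ∀ n, IsOpen (𝒰.U n : Set (absoluteGaloisGroup K)))
    (hN : ⋂ n, (𝒰.U n : Set (absoluteGaloisGroup K)) ⊆ DeShalit1987.rayKer K p S)
    (hcv : IsCosetValues ι v vbar S 𝒰 μ)
    (ιK : K →+* ℂ) (hιK : ∀ k : 𝓞 K, k ∈ v.asIdeal ↔ ‖ι.symm (ιK (k : K))‖ < 1)
    (𝔣 : Ideal (𝓞 K)) (n : ℕ) (hn : 1 ≤ n) (h𝔣 : 𝔣 ≠ ⊥) (h𝔣v : IsCoprime 𝔣 v.asIdeal)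
    (hsupp : ∀ w : HeightOneSpectrum (𝓞 K), w.asIdeal ∣ 𝔣 ↔ (w ∈ S ∨ w = vbar))
    (hw : rootsOfUnityCongruentOne 𝔣 = 1)
    (𝔞 : Ideal (𝓞 K)) (h𝔞 : 𝔞 ≠ ⊥) (hcop : IsCoprime 𝔞 (Ideal.span {(6 : 𝓞 K)} * (𝔣 * v.asIdeal ^ n)))
    (χ : RayGal K (𝔣 * v.asIdeal ^ n) →* ℂˣ)
    (hχ : ∃ δ ∈ relGalSet K (𝔣 * v.asIdeal ^ n) (𝔣 * v.asIdeal ^ (n - 1)), χ δ ≠ 1) :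
    ∃ (L La : PeriodPair) (T : Finset ℂ) (u : rayClassField K (𝔣 * v.asIdeal ^ n))
      (ζ : AlgebraicClosure K) (γ₀ : absoluteGaloisGroup K) (α : (ZMod (p ^ n))ˣ → 𝓞 K),
      (∀ z : ℂ, z ∈ L.lattice ↔ ∃ a ∈ 𝔣 * v.asIdeal ^ n, z = ιK (a : K)) ∧
      La.lattice = idealInvLattice ιK 𝔞 L.lattice ∧ L.IsLatticeReps La T ∧
      algClosureEmb ιK (u : AlgebraicClosure K) = L.deShalitTheta La T 1 ∧
      algClosureEmb ιK ζ = Complex.exp (2 * Real.pi * Complex.I / (p : ℂ) ^ n) ∧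
      (∀ m : ℕ, absRestrictNormalHom (rayClassField K (𝔣 * vbar.asIdeal ^ m)) γ₀ =
        artinSymbol (galFrob K (rayClassField K (𝔣 * vbar.asIdeal ^ m))) (v.asIdeal ^ n)) ∧
      (∀ a, α a - 1 ∈ 𝔣 ∧ α a - ((a : ZMod (p ^ n)).val : 𝓞 K) ∈ v.asIdeal ^ n) ∧
      CosetValueIdentity ι ιK (𝔣 * v.asIdeal ^ n) n 𝔞 χ u γ₀ ζ α μ := by
  have h𝔤 : 𝔣 * v.asIdeal ^ n ≠ ⊥ := mul_ne_zero h𝔣 (pow_ne_zero n v.ne_bot)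
  obtain ⟨L, La, T, u, hL, hLa, hT, hu⟩ :=
    exists_thetaData h24 hK ιK h𝔤 (mul_pow_ne_top hn) h𝔞 hcop
  obtain ⟨ζ, hζ⟩ := exists_orientation (p := p) ιK n
  obtain ⟨γ₀, hγ₀⟩ := exists_frobLift 𝔣 h𝔣 v vbar h𝔣v hne n
  -- `κ`-representatives by CRT (`𝔣 + vⁿ = 1`), k2-g40 `exists_kappaReps` inline
  have hα : ∀ a : (ZMod (p ^ n))ˣ, ∃ x : 𝓞 K,
      x - 1 ∈ 𝔣 ∧ x - ((a : ZMod (p ^ n)).val : 𝓞 K) ∈ v.asIdeal ^ n := by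
    intro a
    obtain ⟨x, hx, y, hy, hxy⟩ := Ideal.isCoprime_iff_exists.mp h𝔣v.pow_right
    refine ⟨1 + ((((a : ZMod (p ^ n)).val : ℕ) : 𝓞 K) - 1) * x, ?_, ?_⟩
    · have : 1 + ((((a : ZMod (p ^ n)).val : ℕ) : 𝓞 K) - 1) * x - 1 =
          ((((a : ZMod (p ^ n)).val : ℕ) : 𝓞 K) - 1) * x := by ring
      rw [this]; exact 𝔣.mul_mem_left _ hx
    · have hx' : x = 1 - y := by rw [← hxy]; ring
      have : 1 + ((((a : ZMod (p ^ n)).val : ℕ) : 𝓞 K) - 1) * x - (((a : ZMod (p ^ n)).val : ℕ) : 𝓞 K) =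
          -(((((a : ZMod (p ^ n)).val : ℕ) : 𝓞 K) - 1) * y) := by rw [hx']; ring
      rw [this]; exact (v.asIdeal ^ n).neg_mem ((v.asIdeal ^ n).mul_mem_left _ hy)
  choose α hα using hα
  have htc : 𝒰.IsTowerContinuous (galCharInv ι (𝔣 * v.asIdeal ^ n) χ) :=
    isTowerContinuous_galCharInv ι hv hvbar h𝔤 (supp_mul_pow hsupp n) χ hU hN
  exact ⟨L, La, T, u, ζ, γ₀, α, hL, hLa, hT, hu, hζ, hγ₀, hα,
    hcv ιK hιK 𝔣 n hn h𝔣 h𝔣v hsupp hw 𝔞 hcop L La T hL hLa hT u hu χ hχ htc ζ hζ γ₀ hγ₀ α hα⟩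

/-! ## §7 Frame form `∫χ̂⁻¹ dμ = c(key)·G(χ⁻¹)·Σ` (k2-g40's consumer lemma + non-vanishing, inline) -/

/-- The smoothing factor `12(χ⁻¹(𝔞) − N𝔞)` is non-zero for `N𝔞 ≥ 2` (k2-g40 `smoothingFactor_ne_zero`,
verbatim: root of unity vs. integer, `ι⁻¹` injective). [cite: deShalit1987, II.5.2 (3) (p. 79)] -/
theorem smoothingFactor_ne_zero (ι : PadicAlgCl p ≃+* ℂ) {𝔤 : Ideal (𝓞 K)}
    (χ : RayGal K 𝔤 →* ℂˣ) (g : RayGal K 𝔤) {N : ℕ} (hN : 2 ≤ N) :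
    12 * (cval ι (χ g)⁻¹ - (N : ℂ_[p])) ≠ 0 := by
  have hfin : IsOfFinOrder (χ g)⁻¹ :=
    isOfFinOrder_inv_iff.mpr (χ.isOfFinOrder (isOfFinOrder_of_finite g))
  have hnorm : ‖(((χ g)⁻¹ : ℂˣ) : ℂ)‖ = 1 := by
    obtain ⟨k, hk, hk1⟩ := hfin.exists_pow_eq_one
    have h1 : ‖(((χ g)⁻¹ : ℂˣ) : ℂ)‖ ^ k = 1 := by
      rw [← norm_pow, ← Units.val_pow_eq_pow_val, hk1, Units.val_one, norm_one]
    exact (pow_eq_one_iff_of_nonneg (norm_nonneg _) hk.ne').mp h1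
  have hneC : (((χ g)⁻¹ : ℂˣ) : ℂ) ≠ (N : ℂ) := by
    intro h
    have : ‖(N : ℂ)‖ = 1 := h ▸ hnorm
    rw [Complex.norm_natCast] at this
    have : (N : ℝ) = 1 := this
    norm_cast at this
    omega
  refine mul_ne_zero (by norm_num) (sub_ne_zero.mpr ?_)
  intro h
  apply hneC
  unfold cval at h
  have h1 : ((ι.symm (((χ g)⁻¹ : ℂˣ) : ℂ) : PadicAlgCl p) : ℂ_[p]) = ((N : PadicAlgCl p) : ℂ_[p]) := by
    rw [PadicComplex.coe_natCast]; exact h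
  rw [PadicComplex.coe_eq, PadicComplex.coe_eq] at h1
  have h' : (ι.symm (((χ g)⁻¹ : ℂˣ) : ℂ) : PadicAlgCl p) = (N : PadicAlgCl p) :=
    (algebraMap (PadicAlgCl p) ℂ_[p]).injective h1
  have := congrArg ι h'
  simpa using this

omit [Fact p.Prime] in
/-- `N𝔞 ≥ 2` for `𝔞 ≠ 0, 𝒪_K`. [folklore] -/
theorem two_le_absNorm {𝔞 : Ideal (𝓞 K)} (h𝔞 : 𝔞 ≠ ⊥) (h𝔞' : 𝔞 ≠ ⊤) : 2 ≤ Ideal.absNorm 𝔞 := by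
  have h0 : Ideal.absNorm 𝔞 ≠ 0 := fun h ↦ h𝔞 (Ideal.absNorm_eq_zero_iff.mp h)
  have h1 : Ideal.absNorm 𝔞 ≠ 1 := fun h ↦ h𝔞' (Ideal.absNorm_eq_one_iff.mp h)
  omega

/-- **Frame form of the consumer identity** (row 84 / k3-g29 `OutOfRangeLogLaw` currency, B65: the
constant `c(key) = (12(χ⁻¹(𝔞) − N𝔞))⁻¹·G(χ⁻¹)` NAMED, nothing netted): for `𝔞 ≠ 𝒪_K` the identity of
`exists_cosetValueIdentity` divides out to `∫ χ̂⁻¹ dμ = c(key) · G(χ⁻¹) · Σ_g χ(g) Log j_p(g·u)`.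
[cite: deShalit1987, II.5.2 (4) (p. 80)] -/
theorem integral_eq_of_cosetValueIdentity {ι : PadicAlgCl p ≃+* ℂ} {ιK : K →+* ℂ}
    {𝔤 : Ideal (𝓞 K)} {n : ℕ} {𝔞 : Ideal (𝓞 K)} (h𝔞 : 𝔞 ≠ ⊥) (h𝔞' : 𝔞 ≠ ⊤)
    {χ : RayGal K 𝔤 →* ℂˣ} {u : rayClassField K 𝔤}
    {γ₀ : absoluteGaloisGroup K} {ζ : AlgebraicClosure K} {α : (ZMod (p ^ n))ˣ → 𝓞 K}
    {𝒰 : SubgroupTower (absoluteGaloisGroup K)} {μ : GroupDistribution 𝒰 ℂ_[p]}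
    (h : CosetValueIdentity ι ιK 𝔤 n 𝔞 χ u γ₀ ζ α μ) :
    μ.integral (galCharInv ι 𝔤 χ) =
      (12 * (cval ι (χ (artinSymbol (galFrob K (rayClassField K 𝔤)) 𝔞))⁻¹ -
        (Ideal.absNorm 𝔞 : ℂ_[p])))⁻¹ * gaussSumInv ι ιK 𝔤 n χ γ₀ ζ α * unitLogSum ι ιK 𝔤 χ u := by
  have hc := smoothingFactor_ne_zero ι χ (artinSymbol (galFrob K (rayClassField K 𝔤)) 𝔞)
    (two_le_absNorm h𝔞 h𝔞')
  unfold CosetValueIdentity at h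
  rw [mul_assoc, ← h, ← mul_assoc, inv_mul_cancel₀ hc, one_mul]


/-! ## PART A′ — k2-g40 strengthened fact VERBATIM (`thmII414_exists_lMeasure_cosetValues`) -/

/-- **de Shalit II.4.14 + II.5.2 on one witness.**  Verbatim `DeShalit1987.thmII414_exists_lMeasure`
with `∧ IsCosetValues ι v vbar S 𝒰 μ` appended inside the inner existential — the cone (II.4.14,
`IsLMeasure`, types `(k,j)`, `0 ≤ −j < k`, i.e. `j < m`) and the finite-order `𝔭`-ramified cosets
(II.5.2 (4), type `(0,0)`, OUTSIDE the cone) are values of the same measure `μ(𝔣)`.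
[cite: deShalit1987, II.4.14 Theorem; II.5.2 Theorem eq. (4)] -/
def thmII414_exists_lMeasure_cosetValues : Prop :=
  ∀ (p : ℕ) [Fact p.Prime] (K : Type) [Field K] [NumberField K], IsImaginaryQuadratic K →
    ∀ (ι : PadicAlgCl p ≃+* ℂ) (v vbar : HeightOneSpectrum (𝓞 K)),
      ((p : ℕ) : 𝓞 K) ∈ v.asIdeal → ((p : ℕ) : 𝓞 K) ∈ vbar.asIdeal → vbar ≠ v →
      (∀ (w : InfinitePlace K) (k : 𝓞 K), k ∈ v.asIdeal ↔ ‖ι.symm (w.embedding (k : K))‖ < 1) →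
    ∃ (Ω δ : ℂ) (Ωp : (unrIntegers p)ˣ), Ω ≠ 0 ∧
      (δ ^ 2 = (NumberField.discr K : ℂ) ∨ δ ^ 2 = -(NumberField.discr K : ℂ)) ∧
      ∀ (S : Finset (HeightOneSpectrum (𝓞 K))), v ∉ S → vbar ∉ S →
        ∃ (𝒰 : SubgroupTower (absoluteGaloisGroup K)) (μ : GroupDistribution 𝒰 ℂ_[p]),
          (∀ n, IsOpen (𝒰.U n : Set (absoluteGaloisGroup K))) ∧
          (⋂ n, (𝒰.U n : Set (absoluteGaloisGroup K))) ⊆ DeShalit1987.rayKer K p S ∧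
          μ.bound ≤ 1 ∧
          DeShalit1987.IsLMeasure ι v vbar S Ω δ ((Ωp : unrIntegers p) : ℂ_[p]) 𝒰 μ ∧
          IsCosetValues ι v vbar S 𝒰 μ

/-- **Projection `A′ → A`** (kernel): the strengthened fact implies the existing named fact, so the
crux's antecedent / the route's cite list are untouched (`exists_of_exists_and` shape). -/
theorem thmII414_exists_lMeasure_of_cosetValues (h : thmII414_exists_lMeasure_cosetValues) :
    DeShalit1987.thmII414_exists_lMeasure := by
  intro p _ K _ _ hK ι v vbar hv hvbar hne hιv
  obtain ⟨Ω, δ, Ωp, hΩ, hδ, hS⟩ := h p K hK ι v vbar hv hvbar hne hιv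
  refine ⟨Ω, δ, Ωp, hΩ, hδ, fun S hvS hvbarS ↦ ?_⟩
  obtain ⟨𝒰, μ, h1, h2, h3, h4, -⟩ := hS S hvS hvbarS
  exact ⟨𝒰, μ, h1, h2, h3, h4⟩

end Summit.BirchSwinnertonDyer.BirchSwinnertonDyer.Cruxes.SplitBadTwoLowerHalfOfFacts.CriticG43.CosetInstancesK2G42

/-! # PART B — k3-g42 `JunctionK3G42` §1–§6 VERBATIM -/

namespace Summit.BirchSwinnertonDyer.BirchSwinnertonDyer.Cruxes.SplitBadTwoLowerHalfOfFacts.CriticG43.JunctionK3G42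

set_option autoImplicit false

open NumberField IsDedekindDomain Field
open Literature.NumberTheory.GaloisRepresentations
open Literature.NumberTheory.EllipticCurves
open Literature.NumberTheory.EllipticCurves.DeShalit1987

variable {p : ℕ} [Fact p.Prime] {K : Type} [Field K] [NumberField K]

/-! ## §1 The Katz object of record attached to an `IsLMeasure` witness -/

section Object

variable {𝒰 : SubgroupTower (absoluteGaloisGroup K)} {κ₁ κ₂ : ZpExtension K p}

/-- **The Katz object of record at the inverse generators**, `G₂(μ, l) ∈ 𝒪_{ℂ_p}⟦T₁⟧⟦T₂⟧`: the two-variable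
Amice transform of the `(−1)`-REFLECTED push-forward `π_*(l·μ)·(−1)` of the `l`-twisted measure along
`σ ↦ (κ₁σ, κ₂σ)` — verbatim the witness inside the tree's
`DeShalit1987.IsKatzDistribution₂.isKatzMeasure₂_amice₂Int_inv` applied to `katzDistribution₂ μ … l …`.
(de Shalit II.4.16 (49) `π_*(λ̂⁻¹μ(𝔣))`, II.4.17 (53)–(54) `G(χ; T₁, T₂)`, read at `(γ₁⁻¹, γ₂⁻¹)`.) -/
def katzObjectInv (μ : GroupDistribution 𝒰 ℂ_[p]) (hb : μ.bound ≤ 1)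
    (hpc : 𝒰.IsTowerContinuous (ZpExtension.pairCoord κ₁ κ₂))
    (l : FramedGaloisRep K (PadicAlgCl p) 1) (hl : 𝒰.IsTowerContinuous (fun σ ↦ avatarValueAt l σ)) :
    PowerSeries (PowerSeries (PadicComplexInt p)) :=
  ((katzDistribution₂ μ hpc l hl).linearMap (-1) 0 0 (-1)).amice₂Int
    (BoundedDistribution.linearMap_neg_one_bound_le ((katzDistribution₂_bound μ hpc l hl).le.trans hb))

/-! ## §2 J-b — THE TRANSPORT: the value of the object of record at ANY pair-point is the Galois integral -/

/-- **J-b «VALUE TRANSPORT AT THE JUNCTION» (kernel).**  For every bounded (`‖μ‖ ≤ 1`) distribution `μ` on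
`Γ_K` along `𝒰`, every tower-continuous `l`, every generator pair `(γ₁, γ₂)` of `(κ₁, κ₂)` and EVERY
rank-one `r` factoring through the pair — no range / infinity-type / ramification / `L`-function
hypothesis — the Katz object of record takes at the consumer's point `(r(γ₁⁻¹) − 1, r(γ₂⁻¹) − 1)` the value

  `∫_{Γ_K} r(σ)·l(σ) dμ(σ)`.

Proof = de Shalit II.4.17 (52)–(54) beyond the cone: `(γ₁⁻¹, γ₂⁻¹)` is a generator pair of the
`(−1)`-twisted pair, through which `r` still factors; its descent `F = pairChar` is a continuous character of
`ℤ_p²` with `F(1,0) = r(γ₁⁻¹)`, `F(0,1) = r(γ₂⁻¹)` (principal units); the character-evaluation theorem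
`hasValueAt₂_amice₂Int` gives the value `∫ F d(π_*(l·μ)·(−1)) = ∫ F∘(−1) dπ_*(l·μ)`, and `F∘(−1)` is the
descent of `r` through `(κ₁, κ₂)`, so the change of variables `integral_katzDistribution₂` yields `∫ r·l dμ`.
The `(−1)`-reflection (the critic's «`δ`/sign conventions of `isKatzDistribution₂` matched once») is
consumed HERE, once, for all points. -/
theorem hasValueAt₂_katzObjectInv (μ : GroupDistribution 𝒰 ℂ_[p]) (hb : μ.bound ≤ 1)
    (hpc : 𝒰.IsTowerContinuous (ZpExtension.pairCoord κ₁ κ₂))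
    (l : FramedGaloisRep K (PadicAlgCl p) 1) (hl : 𝒰.IsTowerContinuous (fun σ ↦ avatarValueAt l σ))
    {γ₁ γ₂ : absoluteGaloisGroup K} (hγ : ZpExtension.IsTopGeneratorPair κ₁ κ₂ γ₁ γ₂)
    {r : FramedGaloisRep K (PadicAlgCl p) 1} (hκ : FactorsThroughPair κ₁ κ₂ r) :
    IntSeries.HasValueAt₂ (katzObjectInv μ hb hpc l hl) (avatarValueAt r γ₁⁻¹ - 1) (avatarValueAt r γ₂⁻¹ - 1)
      (μ.integral fun σ ↦ avatarValueAt r σ * avatarValueAt l σ) := by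
  -- the `(−1)`-twisted pair, its generator pair `(γ₁⁻¹, γ₂⁻¹)`, and the descent of `r` through it
  have hγ' := hγ.unitTwist_neg_one_inv
  have h' : (κ₁.unitTwist (-1)).IsIndependent (κ₂.unitTwist (-1)) := hγ'.isIndependent
  have h : κ₁.IsIndependent κ₂ := hγ.isIndependent
  have hκ' : FactorsThroughPair (κ₁.unitTwist (-1)) (κ₂.unitTwist (-1)) r :=
    (ZpExtension.factorsThroughPair_unitTwist_iff (-1) (-1) r).mpr hκ
  have hD : (katzDistribution₂ μ hpc l hl).bound ≤ 1 := (katzDistribution₂_bound μ hpc l hl).le.trans hb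
  have hFc : IsContinuousChar₂ (ZpExtension.pairChar h' r) := ZpExtension.isContinuousChar₂_pairChar hκ' hγ' h'
  -- character evaluation of the Amice transform of the reflected distribution
  have hval := ((katzDistribution₂ μ hpc l hl).linearMap (-1) 0 0 (-1)).hasValueAt₂_amice₂Int
    (BoundedDistribution.linearMap_neg_one_bound_le hD) hFc
  rw [ZpExtension.pairChar_one_zero hκ' hγ' h', ZpExtension.pairChar_zero_one hκ' hγ' h'] at hval
  -- `F ∘ (−1)` is the descent of `r` through the ORIGINAL pair
  have hFneg : ∀ σ, (ZpExtension.pairChar h' r ∘ linMap (-1) 0 0 (-1)) (ZpExtension.pairCoord κ₁ κ₂ σ) =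
      avatarValueAt r σ := by
    intro σ
    have hFσ : ZpExtension.pairChar h' r (ZpExtension.pairCoord (κ₁.unitTwist (-1)) (κ₂.unitTwist (-1)) σ) =
        avatarValueAt r σ := ZpExtension.pairChar_pairCoord h' hκ' σ
    rw [Function.comp_apply, ← hFσ, ZpExtension.pairCoord_unitTwist_neg_one, linMap_apply,
      ZpExtension.pairCoord_apply]
    simp only [neg_mul, one_mul, zero_mul, add_zero, zero_add, Prod.neg_mk]
  have hFeq : ZpExtension.pairChar h' r ∘ linMap (-1) 0 0 (-1) = ZpExtension.pairChar h r :=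
    ZpExtension.eq_pairChar_of_forall_apply_pairCoord h hκ hFneg
  have hFuc : UniformContinuous (ZpExtension.pairChar h' r) :=
    CompactSpace.uniformContinuous_of_continuous hFc.continuous
  have hGc : UniformContinuous (ZpExtension.pairChar h r) :=
    CompactSpace.uniformContinuous_of_continuous (ZpExtension.continuous_pairChar h hκ)
  have hG1 : ∀ x, ‖ZpExtension.pairChar h r x‖ ≤ 1 := fun x ↦ by
    obtain ⟨σ, rfl⟩ := ZpExtension.pairCoord_surjective h x
    rw [ZpExtension.pairChar_pairCoord h hκ]
    exact (norm_avatarValueAt_eq_one r σ).le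
  -- `∫ F d(D·(−1)) = ∫ F∘(−1) dD = ∫ pairChar dπ_*(l·μ) = ∫ r·l dμ`
  have hint : ((katzDistribution₂ μ hpc l hl).linearMap (-1) 0 0 (-1)).integral (ZpExtension.pairChar h' r) =
      μ.integral (fun σ ↦ avatarValueAt r σ * avatarValueAt l σ) := by
    rw [(katzDistribution₂ μ hpc l hl).integral_linearMap (-1) 0 0 (-1) hFuc, hFeq,
      integral_katzDistribution₂ μ hpc l hl hGc hG1]
    exact μ.integral_congr fun σ ↦ by rw [ZpExtension.pairChar_pairCoord h hκ]
  rw [hint] at hval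
  exact hval

/-- **The consumer's `val` IS the Galois integral** (kernel; values of a convergent two-variable series are
unique): whatever value a downstream argument attaches to the object of record at the point, it equals
`∫ r·l dμ` — so every statement about `val` is a statement in MEASURE currency. -/
theorem value_eq_integral (μ : GroupDistribution 𝒰 ℂ_[p]) (hb : μ.bound ≤ 1)
    (hpc : 𝒰.IsTowerContinuous (ZpExtension.pairCoord κ₁ κ₂))
    (l : FramedGaloisRep K (PadicAlgCl p) 1) (hl : 𝒰.IsTowerContinuous (fun σ ↦ avatarValueAt l σ))
    {γ₁ γ₂ : absoluteGaloisGroup K} (hγ : ZpExtension.IsTopGeneratorPair κ₁ κ₂ γ₁ γ₂)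
    {r : FramedGaloisRep K (PadicAlgCl p) 1} (hκ : FactorsThroughPair κ₁ κ₂ r) {val : ℂ_[p]}
    (hv : IntSeries.HasValueAt₂ (katzObjectInv μ hb hpc l hl) (avatarValueAt r γ₁⁻¹ - 1)
      (avatarValueAt r γ₂⁻¹ - 1) val) :
    val = μ.integral fun σ ↦ avatarValueAt r σ * avatarValueAt l σ :=
  hv.unique (hasValueAt₂_katzObjectInv μ hb hpc l hl hγ hκ)

omit [NumberField K] in
/-- **The integrand `r·l` is the avatar of the PRODUCT character** (kernel): `r(σ)·l(σ) = (r ⊗ det l)(σ)`, so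
`∫ r·l dμ = ∫ ê dμ` with `e := r ⊗ det l` — by the tree's `IsPAdicAvatarOf.mul_twist_outside`, `e` is the
avatar outside `S` of `ε = λρ` (for this stub: `λ = θ_K⁻¹`, `ρ = θ_K(ψ∘c)⁻¹`, `ε = (ψ∘c)⁻¹`, type `(0,−1)` —
OUTSIDE the cone at `v`), i.e. J-c below is literally the frame's `∫ ε̂ dμ`. -/
theorem integral_mul_eq_integral_twist (μ : GroupDistribution 𝒰 ℂ_[p])
    (r l : FramedGaloisRep K (PadicAlgCl p) 1) :
    (μ.integral fun σ ↦ avatarValueAt r σ * avatarValueAt l σ) =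
      μ.integral fun σ ↦ avatarValueAt (FramedRep.twist r (detChar l)) σ :=
  μ.integral_congr fun σ ↦ by rw [avatarValueAt_twist_detChar, mul_comm]

end Object

/-! ## §3 J-a — the FRAME of the object of record (tree, by name) and the witness-level glue -/

section Witness

variable {ι : PadicAlgCl p ≃+* ℂ} {v vbar : HeightOneSpectrum (𝓞 K)} {S : Finset (HeightOneSpectrum (𝓞 K))}
  {Ω δ : ℂ} {Ωp : ℂ_[p]} {𝒰 : SubgroupTower (absoluteGaloisGroup K)} {μ : GroupDistribution 𝒰 ℂ_[p]}
  {κ₁ κ₂ : ZpExtension K p} {γ₁ γ₂ : absoluteGaloisGroup K}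
  {lam : HeckeCharacter K} {l r : FramedGaloisRep K (PadicAlgCl p) 1}

/-- **J-a «FRAME» (tree, one line)**: for an `IsLMeasure` witness `μ` (de Shalit's (49)–(50) on `Γ_K`
along open `𝒰` with `⋂ U_n ⊆ Gal(K̄/K(𝔣p^∞))`), an avatar `l` of `λ` outside `S` with `λ` unramified
outside `S ∪ {w ∣ p}`, and a generator pair, the object of record IS a `λ`-frame at `(γ₁⁻¹, γ₂⁻¹)` —
`IsLMeasure.isKatzDistribution₂` ∘ `IsKatzDistribution₂.isKatzMeasure₂_amice₂Int_inv`. -/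
theorem isKatzMeasure₂_katzObjectInv (hμ : DeShalit1987.IsLMeasure ι v vbar S Ω δ Ωp 𝒰 μ)
    (hU : ∀ n, IsOpen (𝒰.U n : Set (absoluteGaloisGroup K)))
    (hN : ⋂ n, (𝒰.U n : Set (absoluteGaloisGroup K)) ⊆ DeShalit1987.rayKer K p S)
    (hvbar : ((p : ℕ) : 𝓞 K) ∈ vbar.asIdeal) (hb : μ.bound ≤ 1) (hl : IsPAdicAvatarOutside S ι lam l)
    (hlam : ∀ w : HeightOneSpectrum (𝓞 K), w ∉ S → ((p : ℕ) : 𝓞 K) ∉ w.asIdeal → lam.IsUnramifiedAt w)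
    (hγ : ZpExtension.IsTopGeneratorPair κ₁ κ₂ γ₁ γ₂) :
    IsKatzMeasure₂ ι v vbar S κ₁ κ₂ γ₁⁻¹ γ₂⁻¹ lam Ω δ Ωp
      (katzObjectInv μ hb (DeShalit1987.isTowerContinuous_pairCoord κ₁ κ₂ hU hN) l
        (DeShalit1987.isTowerContinuous_avatarValueAt hl hlam hU hN)) :=
  (hμ.isKatzDistribution₂ hU hN hvbar hl hlam hγ.isIndependent).isKatzMeasure₂_amice₂Int_inv
    ((katzDistribution₂_bound μ _ l _).le.trans hb) hγ

/-- **GLUE, witness level (kernel): J-a ∧ J-b ∧ J-c ⟹ R∃ on THIS witness.**  For ANY predicate `P` on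
`ℂ_p` (the consumer's is `‖·‖ = 2^{−M/2}`): if the Galois integral `∫ r·l dμ` satisfies `P`, then SOME Katz
`λ`-frame at `(γ₁⁻¹, γ₂⁻¹)` has at `(r(γ₁⁻¹) − 1, r(γ₂⁻¹) − 1)` SOME value satisfying `P` — the frame
being the object of record and the value the integral.  Road B′ = this theorem on `μ_cons` (after R220 J1),
road A′ = this theorem on the fact's witness (§4): junction J is paid ONCE for both roads. -/
theorem katzValueExists_of_witness {P : ℂ_[p] → Prop}
    (hμ : DeShalit1987.IsLMeasure ι v vbar S Ω δ Ωp 𝒰 μ)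
    (hU : ∀ n, IsOpen (𝒰.U n : Set (absoluteGaloisGroup K)))
    (hN : ⋂ n, (𝒰.U n : Set (absoluteGaloisGroup K)) ⊆ DeShalit1987.rayKer K p S)
    (hvbar : ((p : ℕ) : 𝓞 K) ∈ vbar.asIdeal) (hb : μ.bound ≤ 1) (hl : IsPAdicAvatarOutside S ι lam l)
    (hlam : ∀ w : HeightOneSpectrum (𝓞 K), w ∉ S → ((p : ℕ) : 𝓞 K) ∉ w.asIdeal → lam.IsUnramifiedAt w)
    (hγ : ZpExtension.IsTopGeneratorPair κ₁ κ₂ γ₁ γ₂) (hκ : FactorsThroughPair κ₁ κ₂ r)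
    (hval : P (μ.integral fun σ ↦ avatarValueAt r σ * avatarValueAt l σ)) :
    ∃ G₂ : PowerSeries (PowerSeries (PadicComplexInt p)),
      IsKatzMeasure₂ ι v vbar S κ₁ κ₂ γ₁⁻¹ γ₂⁻¹ lam Ω δ Ωp G₂ ∧
      ∃ val : ℂ_[p], IntSeries.HasValueAt₂ G₂ (avatarValueAt r γ₁⁻¹ - 1) (avatarValueAt r γ₂⁻¹ - 1) val ∧ P val :=
  ⟨_, isKatzMeasure₂_katzObjectInv hμ hU hN hvbar hb hl hlam hγ, _,
    hasValueAt₂_katzObjectInv μ hb _ l _ hγ hκ, hval⟩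

end Witness

/-! ## §4 The cut at FACT level: fact-shape(Extra) ∧ frame data ∧ J-c ⟹ R∃ (glue proved) -/

section Fact

variable {ι : PadicAlgCl p ≃+* ℂ} {v vbar : HeightOneSpectrum (𝓞 K)} {Sθ : Finset (HeightOneSpectrum (𝓞 K))}
  {κ₁ κ₂ : ZpExtension K p} {γ₁ γ₂ : absoluteGaloisGroup K}
  {lam : HeckeCharacter K} {l r : FramedGaloisRep K (PadicAlgCl p) 1}

/-- **SUB-STUB PIECE 1 — the fact SHAPE with an extra conjunct on the witness** (a `Prop`-valued
DEFINITION, not a claim): verbatim the body of `DeShalit1987.thmII414_exists_lMeasure` at `(p, K, ι, v, v̄)`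
with `∧ Extra 𝒰 μ` appended inside the inner existential.  `Extra := fun _ _ ↦ True` is fact A (up to
`∧ True`, `lMeasureFactWith_true_of_thmII414`); `Extra := IsCosetValues ι v v̄ S` (k2-g40, text of record of
road A′) is `thmII414_exists_lMeasure_cosetValues` at `(p, K, ι, v, v̄)` token for token. -/
def LMeasureFactWith (ι : PadicAlgCl p ≃+* ℂ) (v vbar : HeightOneSpectrum (𝓞 K))
    (Extra : Finset (HeightOneSpectrum (𝓞 K)) → (𝒰 : SubgroupTower (absoluteGaloisGroup K)) →
      GroupDistribution 𝒰 ℂ_[p] → Prop) : Prop :=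
  ∃ (Ω δ : ℂ) (Ωp : (unrIntegers p)ˣ), Ω ≠ 0 ∧
    (δ ^ 2 = (NumberField.discr K : ℂ) ∨ δ ^ 2 = -(NumberField.discr K : ℂ)) ∧
    ∀ (S : Finset (HeightOneSpectrum (𝓞 K))), v ∉ S → vbar ∉ S →
      ∃ (𝒰 : SubgroupTower (absoluteGaloisGroup K)) (μ : GroupDistribution 𝒰 ℂ_[p]),
        (∀ n, IsOpen (𝒰.U n : Set (absoluteGaloisGroup K))) ∧
        (⋂ n, (𝒰.U n : Set (absoluteGaloisGroup K))) ⊆ DeShalit1987.rayKer K p S ∧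
        μ.bound ≤ 1 ∧
        DeShalit1987.IsLMeasure ι v vbar S Ω δ ((Ωp : unrIntegers p) : ℂ_[p]) 𝒰 μ ∧
        Extra S 𝒰 μ

/-- **Fact A gives the shape with `Extra := True`** (kernel projection). -/
theorem lMeasureFactWith_true_of_thmII414 (hA : DeShalit1987.thmII414_exists_lMeasure)
    (hK : IsImaginaryQuadratic K) (ι : PadicAlgCl p ≃+* ℂ) (v vbar : HeightOneSpectrum (𝓞 K))
    (hv : ((p : ℕ) : 𝓞 K) ∈ v.asIdeal) (hvbar : ((p : ℕ) : 𝓞 K) ∈ vbar.asIdeal) (hne : vbar ≠ v)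
    (hι : ∀ (w : InfinitePlace K) (k : 𝓞 K), k ∈ v.asIdeal ↔ ‖ι.symm (w.embedding (k : K))‖ < 1) :
    LMeasureFactWith ι v vbar (fun _ _ _ ↦ True) := by
  obtain ⟨Ω, δ, Ωp, hΩ, hδ, hS⟩ := hA p K hK ι v vbar hv hvbar hne hι
  refine ⟨Ω, δ, Ωp, hΩ, hδ, fun S hvS hvbarS ↦ ?_⟩
  obtain ⟨𝒰, μ, h1, h2, h3, h4⟩ := hS S hvS hvbarS
  exact ⟨𝒰, μ, h1, h2, h3, h4, trivial⟩

/-- **SUB-STUB PIECE 3 — J-c «THE VALUE IN MEASURE CURRENCY»** (a `Prop`-valued DEFINITION, not a claim;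
the RESIDUAL of the cut = the output of HARDEST (a) ⊕ (b)): for EVERY admissible period triple and EVERY
witness `(𝒰, μ)` of the fact at the tame set `Sθ` carrying `Extra` (road A′: `IsCosetValues`), the Galois
integral of `r·l` satisfies `P` (the consumer's `P` is `‖·‖_{ℂ₂} = 2^{−M/2}`).  `∀`-keyed over witnesses
(G1-style, CRITIC-ROWS-g39 (e)): NO uniqueness of de Shalit's measure is consumed (K30/K53). -/
def MeasureValue (ι : PadicAlgCl p ≃+* ℂ) (v vbar : HeightOneSpectrum (𝓞 K)) (Sθ : Finset (HeightOneSpectrum (𝓞 K)))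
    (Extra : Finset (HeightOneSpectrum (𝓞 K)) → (𝒰 : SubgroupTower (absoluteGaloisGroup K)) →
      GroupDistribution 𝒰 ℂ_[p] → Prop)
    (r l : FramedGaloisRep K (PadicAlgCl p) 1) (P : ℂ_[p] → Prop) : Prop :=
  ∀ (Ω δ : ℂ) (Ωp : (unrIntegers p)ˣ) (𝒰 : SubgroupTower (absoluteGaloisGroup K)) (μ : GroupDistribution 𝒰 ℂ_[p]),
    (∀ n, IsOpen (𝒰.U n : Set (absoluteGaloisGroup K))) →
    (⋂ n, (𝒰.U n : Set (absoluteGaloisGroup K))) ⊆ DeShalit1987.rayKer K p Sθ → μ.bound ≤ 1 →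
    DeShalit1987.IsLMeasure ι v vbar Sθ Ω δ ((Ωp : unrIntegers p) : ℂ_[p]) 𝒰 μ → Extra Sθ 𝒰 μ →
    P (μ.integral fun σ ↦ avatarValueAt r σ * avatarValueAt l σ)

/-- **SUB-STUB PIECE 2 — the FRAME DATA at the tame set** (a `Prop`-valued DEFINITION, not a claim; the
home of K3 «generator match» / the frame's (F1)–(F3) bookkeeping): `v, v̄ ∉ Sθ`, `l` is an avatar of `λ`
outside `Sθ`, `λ` is unramified outside `Sθ ∪ {v, v̄}`, `(γ₁, γ₂)` generates `(κ₁, κ₂)`, `r` factors through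
the pair.  For this stub: `λ = θ_K⁻¹` (`l` from the consumer's `θ` via `IsHeckeCharOf ι θ θK`), `r` = the
consumer's `r` (`hrpair`). -/
def FrameData (ι : PadicAlgCl p ≃+* ℂ) (v vbar : HeightOneSpectrum (𝓞 K)) (Sθ : Finset (HeightOneSpectrum (𝓞 K)))
    (κ₁ κ₂ : ZpExtension K p) (γ₁ γ₂ : absoluteGaloisGroup K) (lam : HeckeCharacter K)
    (l r : FramedGaloisRep K (PadicAlgCl p) 1) : Prop :=
  v ∉ Sθ ∧ vbar ∉ Sθ ∧ IsPAdicAvatarOutside Sθ ι lam l ∧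
    (∀ w : HeightOneSpectrum (𝓞 K), w ∉ Sθ → w ≠ v → w ≠ vbar → lam.IsUnramifiedAt w) ∧
    ZpExtension.IsTopGeneratorPair κ₁ κ₂ γ₁ γ₂ ∧ FactorsThroughPair κ₁ κ₂ r

/-- **THE GLUE OF THE CUT (kernel): PIECE 1 (fact shape, any `Extra`) → PIECE 2 (frame data) → PIECE 3 (J-c)
→ R∃**, in the consumer's currency (`Ω ≠ 0`, `δ² = ±d_K`, `Ω_p ∈ (𝒪^{unr})ˣ`, `IsKatzMeasure₂` of the
`λ`-frame at the inverse generators, a value at `(r(γ₁⁻¹) − 1, r(γ₂⁻¹) − 1)` satisfying `P`).  The proof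
runs J-a and J-b on the fact's witness at `S = Sθ`. -/
theorem katzValueExists_of_cut
    {Extra : Finset (HeightOneSpectrum (𝓞 K)) → (𝒰 : SubgroupTower (absoluteGaloisGroup K)) →
      GroupDistribution 𝒰 ℂ_[p] → Prop} {P : ℂ_[p] → Prop}
    (hfact : LMeasureFactWith ι v vbar Extra)
    (hv : ((p : ℕ) : 𝓞 K) ∈ v.asIdeal) (hvbar : ((p : ℕ) : 𝓞 K) ∈ vbar.asIdeal)
    (hframe : FrameData ι v vbar Sθ κ₁ κ₂ γ₁ γ₂ lam l r)
    (hval : MeasureValue ι v vbar Sθ Extra r l P) :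
    ∃ (Ω δ : ℂ) (Ωp : (unrIntegers p)ˣ) (G₂ : PowerSeries (PowerSeries (PadicComplexInt p))),
      Ω ≠ 0 ∧ (δ ^ 2 = (NumberField.discr K : ℂ) ∨ δ ^ 2 = -(NumberField.discr K : ℂ)) ∧
      IsKatzMeasure₂ ι v vbar Sθ κ₁ κ₂ γ₁⁻¹ γ₂⁻¹ lam Ω δ ((Ωp : unrIntegers p) : ℂ_[p]) G₂ ∧
      ∃ val : ℂ_[p], IntSeries.HasValueAt₂ G₂ (avatarValueAt r γ₁⁻¹ - 1) (avatarValueAt r γ₂⁻¹ - 1) val ∧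
        P val := by
  obtain ⟨hvS, hvbarS, hl, hlam, hγ, hκ⟩ := hframe
  obtain ⟨Ω, δ, Ωp, hΩ, hδ, hS⟩ := hfact
  obtain ⟨𝒰, μ, hU, hN, hb, hμ, hE⟩ := hS Sθ hvS hvbarS
  have hlam' : ∀ w : HeightOneSpectrum (𝓞 K), w ∉ Sθ → ((p : ℕ) : 𝓞 K) ∉ w.asIdeal → lam.IsUnramifiedAt w :=
    fun w hwS hwp ↦ hlam w hwS (fun h ↦ hwp (h ▸ hv)) (fun h ↦ hwp (h ▸ hvbar))
  obtain ⟨G₂, hG₂, val, hvalG, hP⟩ := katzValueExists_of_witness hμ hU hN hvbar hb hl hlam' hγ hκ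
    (hval Ω δ Ωp 𝒰 μ hU hN hb hμ hE)
  exact ⟨Ω, δ, Ωp, G₂, hΩ, hδ, hG₂, val, hvalG, hP⟩

/-- **Road A (cite world, fact A as it stands): `thmII414_exists_lMeasure` ∧ frame data ∧ J-c(Extra := True)
⟹ R∃** (kernel). -/
theorem katzValueExists_of_thmII414 {P : ℂ_[p] → Prop}
    (hA : DeShalit1987.thmII414_exists_lMeasure) (hK : IsImaginaryQuadratic K)
    (hv : ((p : ℕ) : 𝓞 K) ∈ v.asIdeal) (hvbar : ((p : ℕ) : 𝓞 K) ∈ vbar.asIdeal) (hne : vbar ≠ v)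
    (hι : ∀ (w : InfinitePlace K) (k : 𝓞 K), k ∈ v.asIdeal ↔ ‖ι.symm (w.embedding (k : K))‖ < 1)
    (hframe : FrameData ι v vbar Sθ κ₁ κ₂ γ₁ γ₂ lam l r)
    (hval : MeasureValue ι v vbar Sθ (fun _ _ _ ↦ True) r l P) :
    ∃ (Ω δ : ℂ) (Ωp : (unrIntegers p)ˣ) (G₂ : PowerSeries (PowerSeries (PadicComplexInt p))),
      Ω ≠ 0 ∧ (δ ^ 2 = (NumberField.discr K : ℂ) ∨ δ ^ 2 = -(NumberField.discr K : ℂ)) ∧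
      IsKatzMeasure₂ ι v vbar Sθ κ₁ κ₂ γ₁⁻¹ γ₂⁻¹ lam Ω δ ((Ωp : unrIntegers p) : ℂ_[p]) G₂ ∧
      ∃ val : ℂ_[p], IntSeries.HasValueAt₂ G₂ (avatarValueAt r γ₁⁻¹ - 1) (avatarValueAt r γ₂⁻¹ - 1) val ∧
        P val :=
  katzValueExists_of_cut (lMeasureFactWith_true_of_thmII414 hA hK ι v vbar hv hvbar hne hι) hv hvbar hframe hval

end Fact

/-! ## §4b The WEAKEST residual: ONE witness (∃-keyed) — no fact hypothesis at all -/

section Exists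

variable {ι : PadicAlgCl p ≃+* ℂ} {v vbar : HeightOneSpectrum (𝓞 K)} {Sθ : Finset (HeightOneSpectrum (𝓞 K))}
  {κ₁ κ₂ : ZpExtension K p} {γ₁ γ₂ : absoluteGaloisGroup K}
  {lam : HeckeCharacter K} {l r : FramedGaloisRep K (PadicAlgCl p) 1}

/-- **J-c∃ «ONE WITNESS»** (a `Prop`-valued DEFINITION, not a claim): SOME admissible period triple and
SOME `IsLMeasure` witness `(𝒰, μ)` at the tame set `Sθ` whose Galois integral of `r·l` satisfies `P`.
By J-a ⊕ J-b this ALONE (with the frame data) gives R∃ — it is what LOWER needs in measure currency,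
nothing more; the `∀`-keyed `MeasureValue` ⊕ the fact is one way to produce it (`measureValueWitness_of_cut`). -/
def MeasureValueWitness (ι : PadicAlgCl p ≃+* ℂ) (v vbar : HeightOneSpectrum (𝓞 K))
    (Sθ : Finset (HeightOneSpectrum (𝓞 K))) (r l : FramedGaloisRep K (PadicAlgCl p) 1)
    (P : ℂ_[p] → Prop) : Prop :=
  ∃ (Ω δ : ℂ) (Ωp : (unrIntegers p)ˣ) (𝒰 : SubgroupTower (absoluteGaloisGroup K)) (μ : GroupDistribution 𝒰 ℂ_[p]),
    Ω ≠ 0 ∧ (δ ^ 2 = (NumberField.discr K : ℂ) ∨ δ ^ 2 = -(NumberField.discr K : ℂ)) ∧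
    (∀ n, IsOpen (𝒰.U n : Set (absoluteGaloisGroup K))) ∧
    (⋂ n, (𝒰.U n : Set (absoluteGaloisGroup K))) ⊆ DeShalit1987.rayKer K p Sθ ∧ μ.bound ≤ 1 ∧
    DeShalit1987.IsLMeasure ι v vbar Sθ Ω δ ((Ωp : unrIntegers p) : ℂ_[p]) 𝒰 μ ∧
    P (μ.integral fun σ ↦ avatarValueAt r σ * avatarValueAt l σ)

/-- **GLUE (∃ form, kernel): frame data ∧ ONE witness ⟹ R∃.** -/
theorem katzValueExists_of_measureValueWitness {P : ℂ_[p] → Prop}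
    (hv : ((p : ℕ) : 𝓞 K) ∈ v.asIdeal) (hvbar : ((p : ℕ) : 𝓞 K) ∈ vbar.asIdeal)
    (hframe : FrameData ι v vbar Sθ κ₁ κ₂ γ₁ γ₂ lam l r)
    (hW : MeasureValueWitness ι v vbar Sθ r l P) :
    ∃ (Ω δ : ℂ) (Ωp : (unrIntegers p)ˣ) (G₂ : PowerSeries (PowerSeries (PadicComplexInt p))),
      Ω ≠ 0 ∧ (δ ^ 2 = (NumberField.discr K : ℂ) ∨ δ ^ 2 = -(NumberField.discr K : ℂ)) ∧
      IsKatzMeasure₂ ι v vbar Sθ κ₁ κ₂ γ₁⁻¹ γ₂⁻¹ lam Ω δ ((Ωp : unrIntegers p) : ℂ_[p]) G₂ ∧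
      ∃ val : ℂ_[p], IntSeries.HasValueAt₂ G₂ (avatarValueAt r γ₁⁻¹ - 1) (avatarValueAt r γ₂⁻¹ - 1) val ∧
        P val := by
  obtain ⟨-, -, hl, hlam, hγ, hκ⟩ := hframe
  obtain ⟨Ω, δ, Ωp, 𝒰, μ, hΩ, hδ, hU, hN, hb, hμ, hP⟩ := hW
  have hlam' : ∀ w : HeightOneSpectrum (𝓞 K), w ∉ Sθ → ((p : ℕ) : 𝓞 K) ∉ w.asIdeal → lam.IsUnramifiedAt w :=
    fun w hwS hwp ↦ hlam w hwS (fun h ↦ hwp (h ▸ hv)) (fun h ↦ hwp (h ▸ hvbar))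
  obtain ⟨G₂, hG₂, val, hvalG, hPv⟩ := katzValueExists_of_witness hμ hU hN hvbar hb hl hlam' hγ hκ hP
  exact ⟨Ω, δ, Ωp, G₂, hΩ, hδ, hG₂, val, hvalG, hPv⟩

/-- **The `∀`-keyed cut produces the witness** (kernel): fact shape (any `Extra`) ∧ `v, v̄ ∉ Sθ` ∧
`MeasureValue` ⟹ `MeasureValueWitness`. -/
theorem measureValueWitness_of_cut
    {Extra : Finset (HeightOneSpectrum (𝓞 K)) → (𝒰 : SubgroupTower (absoluteGaloisGroup K)) →
      GroupDistribution 𝒰 ℂ_[p] → Prop} {P : ℂ_[p] → Prop}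
    (hfact : LMeasureFactWith ι v vbar Extra) (hvS : v ∉ Sθ) (hvbarS : vbar ∉ Sθ)
    (hval : MeasureValue ι v vbar Sθ Extra r l P) :
    MeasureValueWitness ι v vbar Sθ r l P := by
  obtain ⟨Ω, δ, Ωp, hΩ, hδ, hS⟩ := hfact
  obtain ⟨𝒰, μ, hU, hN, hb, hμ, hE⟩ := hS Sθ hvS hvbarS
  exact ⟨Ω, δ, Ωp, 𝒰, μ, hΩ, hδ, hU, hN, hb, hμ, hval Ω δ Ωp 𝒰 μ hU hN hb hμ hE⟩

end Exists


/-! ## §5 The stub's instance: `p = 2`, `λ = θ_K⁻¹`, `P = (‖·‖ = 2^{−M/2})` — the consumer's `hR` token for token -/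

section Two

variable {K : Type} [Field K] [NumberField K]
  {ι : PadicAlgCl 2 ≃+* ℂ} {v vbar : HeightOneSpectrum (𝓞 K)} {Sθ : Finset (HeightOneSpectrum (𝓞 K))}
  {κ₁ κ₂ : ZpExtension K 2} {γ₁ γ₂ : absoluteGaloisGroup K}
  {θK : HeckeCharacter K} {l r : FramedGaloisRep K (PadicAlgCl 2) 1}

/-- **R∃ AT `p = 2` FROM THE CUT (kernel)** — conclusion = the binder `hR` of
`RubinValueTwoLower.lower_two_of_DGal_of_subsetForall_of_katzValueExists` VERBATIM (`Sθ`, `θK⁻¹`,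
`(Ωp : unrIntegers 2 : ℂ_[2])`, `‖val‖ = 2^{−M/2}`): the LOWER junction consumes, in measure currency, exactly
`MeasureValue ι v v̄ Sθ Extra r l (‖·‖ = 2^{−M/2})` — ONE norm of ONE Galois integral per witness. -/
theorem katzValueExists_two
    {Extra : Finset (HeightOneSpectrum (𝓞 K)) → (𝒰 : SubgroupTower (absoluteGaloisGroup K)) →
      GroupDistribution 𝒰 ℂ_[2] → Prop} {M : ℤ}
    (hfact : LMeasureFactWith ι v vbar Extra)
    (hv : ((2 : ℕ) : 𝓞 K) ∈ v.asIdeal) (hvbar : ((2 : ℕ) : 𝓞 K) ∈ vbar.asIdeal)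
    (hframe : FrameData ι v vbar Sθ κ₁ κ₂ γ₁ γ₂ θK⁻¹ l r)
    (hval : MeasureValue ι v vbar Sθ Extra r l (fun z ↦ ‖z‖ = (2 : ℝ) ^ (-(M : ℝ) / 2))) :
    ∃ (Ω δ : ℂ) (Ωp : (unrIntegers 2)ˣ) (G₂ : PowerSeries (PowerSeries (PadicComplexInt 2))),
      Ω ≠ 0 ∧ (δ ^ 2 = (NumberField.discr K : ℂ) ∨ δ ^ 2 = -(NumberField.discr K : ℂ)) ∧
      IsKatzMeasure₂ ι v vbar Sθ κ₁ κ₂ γ₁⁻¹ γ₂⁻¹ θK⁻¹ Ω δ ((Ωp : unrIntegers 2) : ℂ_[2]) G₂ ∧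
      ∃ val : ℂ_[2], IntSeries.HasValueAt₂ G₂ (avatarValueAt r γ₁⁻¹ - 1) (avatarValueAt r γ₂⁻¹ - 1) val ∧
        ‖val‖ = (2 : ℝ) ^ (-(M : ℝ) / 2) :=
  katzValueExists_of_cut hfact hv hvbar hframe hval

end Two

/-! ## §6 Degenerate-instance checks (B68): the pieces are not vacuous / not trivially true -/

section Checks

variable {𝒰 : SubgroupTower (absoluteGaloisGroup K)} {κ₁ κ₂ : ZpExtension K p}

/-- (B68-i) J-b is NOT an instance of the frame: it holds with NO `IsLMeasure` hypothesis at all (the zero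
measure included) — at `μ` with `∫ ≡ 0`-style degenerate data the value is the integral, whatever it is; the
content of J-b is the IDENTIFICATION, and the frame J-a is where (49)–(50) enter.  Recorded as the trivial
re-export below so the critic can see the hypothesis list of J-b contains no `L`-function datum. -/
theorem hasValueAt₂_katzObjectInv_hypotheses (μ : GroupDistribution 𝒰 ℂ_[p]) (hb : μ.bound ≤ 1)
    (hpc : 𝒰.IsTowerContinuous (ZpExtension.pairCoord κ₁ κ₂))
    (l : FramedGaloisRep K (PadicAlgCl p) 1) (hl : 𝒰.IsTowerContinuous (fun σ ↦ avatarValueAt l σ))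
    {γ₁ γ₂ : absoluteGaloisGroup K} (hγ : ZpExtension.IsTopGeneratorPair κ₁ κ₂ γ₁ γ₂)
    {r : FramedGaloisRep K (PadicAlgCl p) 1} (hκ : FactorsThroughPair κ₁ κ₂ r) :
    ∃ val : ℂ_[p], IntSeries.HasValueAt₂ (katzObjectInv μ hb hpc l hl) (avatarValueAt r γ₁⁻¹ - 1)
      (avatarValueAt r γ₂⁻¹ - 1) val ∧ val = μ.integral fun σ ↦ avatarValueAt r σ * avatarValueAt l σ :=
  ⟨_, hasValueAt₂_katzObjectInv μ hb hpc l hl hγ hκ, rfl⟩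

/-- (B68-ii) `MeasureValue` is NOT vacuous whenever the fact shape holds at `Sθ ∌ v, v̄`: it is then
EQUIVALENT to its instance on some witness existing — in particular `MeasureValue … (fun _ ↦ False)` is
refutable (so the `∀`-keying hides no empty quantifier). -/
theorem not_measureValue_false {ι : PadicAlgCl p ≃+* ℂ} {v vbar : HeightOneSpectrum (𝓞 K)}
    {Sθ : Finset (HeightOneSpectrum (𝓞 K))}
    {Extra : Finset (HeightOneSpectrum (𝓞 K)) → (𝒰 : SubgroupTower (absoluteGaloisGroup K)) →
      GroupDistribution 𝒰 ℂ_[p] → Prop}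
    (hfact : LMeasureFactWith ι v vbar Extra) (hvS : v ∉ Sθ) (hvbarS : vbar ∉ Sθ)
    (r l : FramedGaloisRep K (PadicAlgCl p) 1) :
    ¬ MeasureValue ι v vbar Sθ Extra r l (fun _ ↦ False) := by
  intro h
  obtain ⟨Ω, δ, Ωp, -, -, hS⟩ := hfact
  obtain ⟨𝒰, μ, hU, hN, hb, hμ, hE⟩ := hS Sθ hvS hvbarS
  exact h Ω δ Ωp 𝒰 μ hU hN hb hμ hE

end Checks

end Summit.BirchSwinnertonDyer.BirchSwinnertonDyer.Cruxes.SplitBadTwoLowerHalfOfFacts.CriticG43.JunctionK3G42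

/-! # PART C — the critic's junction theorems J19–J24 (stub-critic g43) -/

namespace Summit.BirchSwinnertonDyer.BirchSwinnertonDyer.Cruxes.SplitBadTwoLowerHalfOfFacts.CriticG43.Junction

set_option autoImplicit false

open scoped Classical
open NumberField IsDedekindDomain Field
open Literature.NumberTheory.GaloisRepresentations
open Literature.NumberTheory.EllipticCurves
open Literature.NumberTheory.EllipticCurves.DeShalit1987
open Literature.NumberTheory.ComplexMultiplication.EllipticUnits
open Literature.NumberTheory.NumberFields (rayClassField isUnramifiedIn_rayClassField)
open Literature.NumberTheory.LFunctions.AbelianDensity (artinSymbol artinSymbol_finsuppProd)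
open Summit.BirchSwinnertonDyer.BirchSwinnertonDyer.Cruxes.SplitBadTwoLowerHalfOfFacts.CriticG43
open Summit.BirchSwinnertonDyer.BirchSwinnertonDyer.Cruxes.SplitBadTwoLowerHalfOfFacts.CriticG43.JunctionK3G42
  (LMeasureFactWith FrameData MeasureValue MeasureValueWitness katzValueExists_of_cut measureValueWitness_of_cut)
open Summit.BirchSwinnertonDyer.BirchSwinnertonDyer.Cruxes.SplitBadTwoLowerHalfOfFacts.CriticG43.CosetInstancesK2G42
  (IsCosetValues CosetValueIdentity RayGal galCharInv thmII414_exists_lMeasure_cosetValues exists_cosetValueIdentity)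

/-! ## J19′ / J20′ — global (∀-closed) identifications, stated before any section variable is in scope -/

/-- **J19′** (kernel, `Iff.rfl`): k3-g42's cut PIECE 1 with `Extra := IsCosetValues ι v v̄`, closed over all
frames `(p, K, ι, v, v̄)`, IS k2-g40's strengthened fact A′ `thmII414_exists_lMeasure_cosetValues` — token for
token up to δ-unfolding of `LMeasureFactWith`. -/
theorem forall_lMeasureFactWith_cosetValues_iff :
    (∀ (p : ℕ) [Fact p.Prime] (K : Type) [Field K] [NumberField K], IsImaginaryQuadratic K →
      ∀ (ι : PadicAlgCl p ≃+* ℂ) (v vbar : HeightOneSpectrum (𝓞 K)),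
        ((p : ℕ) : 𝓞 K) ∈ v.asIdeal → ((p : ℕ) : 𝓞 K) ∈ vbar.asIdeal → vbar ≠ v →
        (∀ (w : InfinitePlace K) (k : 𝓞 K), k ∈ v.asIdeal ↔ ‖ι.symm (w.embedding (k : K))‖ < 1) →
        LMeasureFactWith ι v vbar (IsCosetValues ι v vbar)) ↔
    thmII414_exists_lMeasure_cosetValues :=
  Iff.rfl

section General

variable {p : ℕ} [Fact p.Prime] {K : Type} [Field K] [NumberField K]

/-- **J19** (kernel, application): fact A′ ⟹ PIECE 1 at `Extra := IsCosetValues` for the given frame. -/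
theorem lMeasureFactWith_cosetValues_of_fact (h : thmII414_exists_lMeasure_cosetValues)
    (hK : IsImaginaryQuadratic K) (ι : PadicAlgCl p ≃+* ℂ) (v vbar : HeightOneSpectrum (𝓞 K))
    (hv : ((p : ℕ) : 𝓞 K) ∈ v.asIdeal) (hvbar : ((p : ℕ) : 𝓞 K) ∈ vbar.asIdeal) (hne : vbar ≠ v)
    (hι : ∀ (w : InfinitePlace K) (k : 𝓞 K), k ∈ v.asIdeal ↔ ‖ι.symm (w.embedding (k : K))‖ < 1) :
    LMeasureFactWith ι v vbar (IsCosetValues ι v vbar) :=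
  h p K hK ι v vbar hv hvbar hne hι

/-- **J20** (kernel): PIECE 1 at `Extra := ⊤` is, instance-wise, the body of de Shalit II.4.14
(`DeShalit1987.thmII414_exists_lMeasure`) — the «Extra dial» at zero. -/
theorem lMeasureFactWith_true_iff (ι : PadicAlgCl p ≃+* ℂ) (v vbar : HeightOneSpectrum (𝓞 K)) :
    LMeasureFactWith ι v vbar (fun _ _ _ ↦ True) ↔
    ∃ (Ω δ : ℂ) (Ωp : (unrIntegers p)ˣ), Ω ≠ 0 ∧
      (δ ^ 2 = (NumberField.discr K : ℂ) ∨ δ ^ 2 = -(NumberField.discr K : ℂ)) ∧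
      ∀ (S : Finset (HeightOneSpectrum (𝓞 K))), v ∉ S → vbar ∉ S →
        ∃ (𝒰 : SubgroupTower (absoluteGaloisGroup K)) (μ : GroupDistribution 𝒰 ℂ_[p]),
          (∀ n, IsOpen (𝒰.U n : Set (absoluteGaloisGroup K))) ∧
          (⋂ n, (𝒰.U n : Set (absoluteGaloisGroup K))) ⊆ DeShalit1987.rayKer K p S ∧
          μ.bound ≤ 1 ∧
          DeShalit1987.IsLMeasure ι v vbar S Ω δ ((Ωp : unrIntegers p) : ℂ_[p]) 𝒰 μ := by
  constructor
  · rintro ⟨Ω, δ, Ωp, hΩ, hδ, hS⟩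
    refine ⟨Ω, δ, Ωp, hΩ, hδ, fun S hvS hvbarS ↦ ?_⟩
    obtain ⟨𝒰, μ, h1, h2, h3, h4, -⟩ := hS S hvS hvbarS
    exact ⟨𝒰, μ, h1, h2, h3, h4⟩
  · rintro ⟨Ω, δ, Ωp, hΩ, hδ, hS⟩
    refine ⟨Ω, δ, Ωp, hΩ, hδ, fun S hvS hvbarS ↦ ?_⟩
    obtain ⟨𝒰, μ, h1, h2, h3, h4⟩ := hS S hvS hvbarS
    exact ⟨𝒰, μ, h1, h2, h3, h4, trivial⟩

/-- **J21a** (kernel): PIECE 1 is MONOTONE in `Extra` (weakening the side condition keeps the fact). -/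
theorem lMeasureFactWith_mono {ι : PadicAlgCl p ≃+* ℂ} {v vbar : HeightOneSpectrum (𝓞 K)}
    {Extra Extra' : Finset (HeightOneSpectrum (𝓞 K)) → (𝒰 : SubgroupTower (absoluteGaloisGroup K)) →
      GroupDistribution 𝒰 ℂ_[p] → Prop}
    (hE : ∀ S (𝒰 : SubgroupTower (absoluteGaloisGroup K)) (μ : GroupDistribution 𝒰 ℂ_[p]), Extra S 𝒰 μ → Extra' S 𝒰 μ)
    (h : LMeasureFactWith ι v vbar Extra) : LMeasureFactWith ι v vbar Extra' := by
  obtain ⟨Ω, δ, Ωp, hΩ, hδ, hS⟩ := h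
  refine ⟨Ω, δ, Ωp, hΩ, hδ, fun S hvS hvbarS ↦ ?_⟩
  obtain ⟨𝒰, μ, h1, h2, h3, h4, h5⟩ := hS S hvS hvbarS
  exact ⟨𝒰, μ, h1, h2, h3, h4, hE S 𝒰 μ h5⟩

/-- **J21b** (kernel): PIECE 3 is ANTITONE in `Extra` (a stronger side condition on the witness makes the
value obligation weaker) — together with J21a this is the «Extra dial»: A′ (`IsCosetValues`) sits between
`⊤` (road RT⁺, cite world) and any sharper coset package a producer may later extract from II.5.2. -/
theorem measureValue_anti {ι : PadicAlgCl p ≃+* ℂ} {v vbar : HeightOneSpectrum (𝓞 K)}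
    {Sθ : Finset (HeightOneSpectrum (𝓞 K))}
    {Extra Extra' : Finset (HeightOneSpectrum (𝓞 K)) → (𝒰 : SubgroupTower (absoluteGaloisGroup K)) →
      GroupDistribution 𝒰 ℂ_[p] → Prop}
    (hE : ∀ S (𝒰 : SubgroupTower (absoluteGaloisGroup K)) (μ : GroupDistribution 𝒰 ℂ_[p]), Extra S 𝒰 μ → Extra' S 𝒰 μ)
    {r l : FramedGaloisRep K (PadicAlgCl p) 1} {P : ℂ_[p] → Prop}
    (h : MeasureValue ι v vbar Sθ Extra' r l P) : MeasureValue ι v vbar Sθ Extra r l P :=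
  fun Ω δ Ωp 𝒰 μ hU hN hb hμ hx ↦ h Ω δ Ωp 𝒰 μ hU hN hb hμ (hE Sθ 𝒰 μ hx)

/-- **J21c** (kernel): PIECE 3 is MONOTONE in the value predicate `P`. -/
theorem measureValue_mono_right {ι : PadicAlgCl p ≃+* ℂ} {v vbar : HeightOneSpectrum (𝓞 K)}
    {Sθ : Finset (HeightOneSpectrum (𝓞 K))}
    {Extra : Finset (HeightOneSpectrum (𝓞 K)) → (𝒰 : SubgroupTower (absoluteGaloisGroup K)) →
      GroupDistribution 𝒰 ℂ_[p] → Prop}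
    {r l : FramedGaloisRep K (PadicAlgCl p) 1} {P P' : ℂ_[p] → Prop} (hP : ∀ z, P z → P' z)
    (h : MeasureValue ι v vbar Sθ Extra r l P) : MeasureValue ι v vbar Sθ Extra r l P' :=
  fun Ω δ Ωp 𝒰 μ hU hN hb hμ hx ↦ hP _ (h Ω δ Ωp 𝒰 μ hU hN hb hμ hx)

/-- **J23** (kernel; A′ END-TO-END ON ONE WITNESS): from PIECE 1 at `Extra := IsCosetValues` and `v, v̄ ∉ S`,
the fact's OWN witness `(Ω, δ, Ωp, 𝒰, μ)` at `S` is an L-measure AND carries k2-g42's value identity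
`CosetValueIdentity` (II.5.2 (4), smoothed by `𝔞`) at every admissible key `(𝔣, n, 𝔞, χ)` — one `obtain`
from the fact, one call of k2-g42's `exists_cosetValueIdentity`.  This is exactly what the LOWER receptacle
`MeasureValue ι v v̄ Sθ (IsCosetValues ι v v̄) r l P` is allowed to assume about the measure it must evaluate. -/
theorem cosetValueIdentity_on_cut_witness {ι : PadicAlgCl p ≃+* ℂ} {v vbar : HeightOneSpectrum (𝓞 K)}
    (hfact : LMeasureFactWith ι v vbar (IsCosetValues ι v vbar))
    {S : Finset (HeightOneSpectrum (𝓞 K))} (hvS : v ∉ S) (hvbarS : vbar ∉ S)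
    (h24 : DeShalit1987.prop24_i_mem_rayClassField) (hK : IsImaginaryQuadratic K)
    (hv : ((p : ℕ) : 𝓞 K) ∈ v.asIdeal) (hvbar : ((p : ℕ) : 𝓞 K) ∈ vbar.asIdeal) (hne : vbar ≠ v)
    (ιK : K →+* ℂ) (hιK : ∀ k : 𝓞 K, k ∈ v.asIdeal ↔ ‖ι.symm (ιK (k : K))‖ < 1)
    (𝔣 : Ideal (𝓞 K)) (n : ℕ) (hn : 1 ≤ n) (h𝔣 : 𝔣 ≠ ⊥) (h𝔣v : IsCoprime 𝔣 v.asIdeal)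
    (hsupp : ∀ w : HeightOneSpectrum (𝓞 K), w.asIdeal ∣ 𝔣 ↔ (w ∈ S ∨ w = vbar))
    (hw : rootsOfUnityCongruentOne 𝔣 = 1)
    (𝔞 : Ideal (𝓞 K)) (h𝔞 : 𝔞 ≠ ⊥) (hcop : IsCoprime 𝔞 (Ideal.span {(6 : 𝓞 K)} * (𝔣 * v.asIdeal ^ n)))
    (χ : RayGal K (𝔣 * v.asIdeal ^ n) →* ℂˣ)
    (hχ : ∃ δ ∈ relGalSet K (𝔣 * v.asIdeal ^ n) (𝔣 * v.asIdeal ^ (n - 1)), χ δ ≠ 1) :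
    ∃ (Ω δ : ℂ) (Ωp : (unrIntegers p)ˣ) (𝒰 : SubgroupTower (absoluteGaloisGroup K)) (μ : GroupDistribution 𝒰 ℂ_[p]),
      Ω ≠ 0 ∧ (δ ^ 2 = (NumberField.discr K : ℂ) ∨ δ ^ 2 = -(NumberField.discr K : ℂ)) ∧
      (∀ m, IsOpen (𝒰.U m : Set (absoluteGaloisGroup K))) ∧
      (⋂ m, (𝒰.U m : Set (absoluteGaloisGroup K))) ⊆ DeShalit1987.rayKer K p S ∧ μ.bound ≤ 1 ∧
      DeShalit1987.IsLMeasure ι v vbar S Ω δ ((Ωp : unrIntegers p) : ℂ_[p]) 𝒰 μ ∧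
      ∃ (L La : PeriodPair) (T : Finset ℂ) (u : rayClassField K (𝔣 * v.asIdeal ^ n))
        (ζ : AlgebraicClosure K) (γ₀ : absoluteGaloisGroup K) (α : (ZMod (p ^ n))ˣ → 𝓞 K),
        (∀ z : ℂ, z ∈ L.lattice ↔ ∃ a ∈ 𝔣 * v.asIdeal ^ n, z = ιK (a : K)) ∧
        La.lattice = idealInvLattice ιK 𝔞 L.lattice ∧ L.IsLatticeReps La T ∧
        algClosureEmb ιK (u : AlgebraicClosure K) = L.deShalitTheta La T 1 ∧
        algClosureEmb ιK ζ = Complex.exp (2 * Real.pi * Complex.I / (p : ℂ) ^ n) ∧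
        (∀ m : ℕ, absRestrictNormalHom (rayClassField K (𝔣 * vbar.asIdeal ^ m)) γ₀ =
          artinSymbol (galFrob K (rayClassField K (𝔣 * vbar.asIdeal ^ m))) (v.asIdeal ^ n)) ∧
        (∀ a, α a - 1 ∈ 𝔣 ∧ α a - ((a : ZMod (p ^ n)).val : 𝓞 K) ∈ v.asIdeal ^ n) ∧
        CosetValueIdentity ι ιK (𝔣 * v.asIdeal ^ n) n 𝔞 χ u γ₀ ζ α μ := by
  obtain ⟨Ω, δ, Ωp, hΩ, hδ, hS⟩ := hfact
  obtain ⟨𝒰, μ, hU, hN, hb, hμ, hcv⟩ := hS S hvS hvbarS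
  exact ⟨Ω, δ, Ωp, 𝒰, μ, hΩ, hδ, hU, hN, hb, hμ,
    exists_cosetValueIdentity h24 hK hv hvbar hne hU hN hcv ιK hιK 𝔣 n hn h𝔣 h𝔣v hsupp hw 𝔞 h𝔞 hcop χ hχ⟩

/-- **J24** (kernel, definitional): the PRODUCER'S INTERFACE for PIECE 3 at `Extra := IsCosetValues` — to
deliver `MeasureValue ι v v̄ Sθ (IsCosetValues ι v v̄) r l P` it suffices to prove `P (∫ r·l dμ)` for every
L-measure witness `μ` at `Sθ` that carries the coset values; nothing else about `μ` may be used (no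
uniqueness of the L-measure, K53).  Recorded so that R197a″ / R200′(b″) start from a typed goal. -/
theorem measureValue_of_forall_cosetValues {ι : PadicAlgCl p ≃+* ℂ} {v vbar : HeightOneSpectrum (𝓞 K)}
    {Sθ : Finset (HeightOneSpectrum (𝓞 K))} {r l : FramedGaloisRep K (PadicAlgCl p) 1} {P : ℂ_[p] → Prop}
    (h : ∀ (Ω δ : ℂ) (Ωp : (unrIntegers p)ˣ) (𝒰 : SubgroupTower (absoluteGaloisGroup K))
        (μ : GroupDistribution 𝒰 ℂ_[p]),
        (∀ n, IsOpen (𝒰.U n : Set (absoluteGaloisGroup K))) →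
        (⋂ n, (𝒰.U n : Set (absoluteGaloisGroup K))) ⊆ DeShalit1987.rayKer K p Sθ → μ.bound ≤ 1 →
        DeShalit1987.IsLMeasure ι v vbar Sθ Ω δ ((Ωp : unrIntegers p) : ℂ_[p]) 𝒰 μ →
        IsCosetValues ι v vbar Sθ 𝒰 μ →
        P (μ.integral fun σ ↦ avatarValueAt r σ * avatarValueAt l σ)) :
    MeasureValue ι v vbar Sθ (IsCosetValues ι v vbar) r l P :=
  h

end General

/-! ## J22 — the ONE-SIDED junction at `p = 2` (k1-g40 §E: LOWER reads `‖val‖ = 2^{−M/2}` only as `≤`) -/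

section AtTwo

variable {K : Type} [Field K] [NumberField K]

/-- **`KatzValueUpper₂`** = k1-g40's `hRle` binder text VERBATIM (its `lower_two_of_DGal_of_subsetForall_of_katzValueUpper`,
rc 0 / axioms standard, re-run g43): Rubin's value in EXISTENCE form with the INEQUALITY `‖val‖ ≤ 2^{−M/2}`. -/
def KatzValueUpper₂ (ι : PadicAlgCl 2 ≃+* ℂ) (v vbar : HeightOneSpectrum (𝓞 K)) (Sθ : Finset (HeightOneSpectrum (𝓞 K)))
    (κ₁ κ₂ : ZpExtension K 2) (γ₁ γ₂ : absoluteGaloisGroup K) (θK : HeckeCharacter K)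
    (r : FramedGaloisRep K (PadicAlgCl 2) 1) (M : ℤ) : Prop :=
  ∃ (Ω δ : ℂ) (Ωp : (unrIntegers 2)ˣ) (G₂ : PowerSeries (PowerSeries (PadicComplexInt 2))),
      Ω ≠ 0 ∧ (δ ^ 2 = (NumberField.discr K : ℂ) ∨ δ ^ 2 = -(NumberField.discr K : ℂ)) ∧
      IsKatzMeasure₂ ι v vbar Sθ κ₁ κ₂ γ₁⁻¹ γ₂⁻¹ θK⁻¹ Ω δ ((Ωp : unrIntegers 2) : ℂ_[2]) G₂ ∧
      ∃ val : ℂ_[2], IntSeries.HasValueAt₂ G₂ (avatarValueAt r γ₁⁻¹ - 1) (avatarValueAt r γ₂⁻¹ - 1) val ∧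
        ‖val‖ ≤ (2 : ℝ) ^ (-(M : ℝ) / 2)

variable {ι : PadicAlgCl 2 ≃+* ℂ} {v vbar : HeightOneSpectrum (𝓞 K)} {Sθ : Finset (HeightOneSpectrum (𝓞 K))}
  {κ₁ κ₂ : ZpExtension K 2} {γ₁ γ₂ : absoluteGaloisGroup K} {θK : HeckeCharacter K}
  {l r : FramedGaloisRep K (PadicAlgCl 2) 1}

/-- **J22** (kernel): k3-g42's cut at the INEQUALITY — PIECE 1 (any `Extra`) ∧ PIECE 2 ∧ PIECE 3 with
`P := (‖·‖ ≤ 2^{−M/2})` ⟹ k1-g40's one-sided junction `KatzValueUpper₂` (one call of `katzValueExists_of_cut`). -/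
theorem katzValueUpper₂_of_cut
    {Extra : Finset (HeightOneSpectrum (𝓞 K)) → (𝒰 : SubgroupTower (absoluteGaloisGroup K)) →
      GroupDistribution 𝒰 ℂ_[2] → Prop} {M : ℤ}
    (hfact : LMeasureFactWith ι v vbar Extra)
    (hv : ((2 : ℕ) : 𝓞 K) ∈ v.asIdeal) (hvbar : ((2 : ℕ) : 𝓞 K) ∈ vbar.asIdeal)
    (hframe : FrameData ι v vbar Sθ κ₁ κ₂ γ₁ γ₂ θK⁻¹ l r)
    (hval : MeasureValue ι v vbar Sθ Extra r l (fun z ↦ ‖z‖ ≤ (2 : ℝ) ^ (-(M : ℝ) / 2))) :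
    KatzValueUpper₂ ι v vbar Sθ κ₁ κ₂ γ₁ γ₂ θK r M :=
  katzValueExists_of_cut hfact hv hvbar hframe hval

/-- **J22′** (kernel): the equality form of PIECE 3 (k3-g42's `katzValueExists_two`, = the tree consumer's `hR`)
implies the inequality form — so every producer aiming at `=` also feeds the one-sided consumer. -/
theorem measureValue_le_of_eq
    {Extra : Finset (HeightOneSpectrum (𝓞 K)) → (𝒰 : SubgroupTower (absoluteGaloisGroup K)) →
      GroupDistribution 𝒰 ℂ_[2] → Prop} {M : ℤ}
    (hval : MeasureValue ι v vbar Sθ Extra r l (fun z ↦ ‖z‖ = (2 : ℝ) ^ (-(M : ℝ) / 2))) :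
    MeasureValue ι v vbar Sθ Extra r l (fun z ↦ ‖z‖ ≤ (2 : ℝ) ^ (-(M : ℝ) / 2)) :=
  measureValue_mono_right (fun _ h ↦ h.le) hval

/-- **J22″** (kernel): A′ all the way — fact A′ ∧ frame data ∧ the one-sided value bound for every witness
carrying the coset values ⟹ `KatzValueUpper₂` (J19 ∘ J22). -/
theorem katzValueUpper₂_of_factAprime {M : ℤ}
    (hA : thmII414_exists_lMeasure_cosetValues) (hK : IsImaginaryQuadratic K)
    (hv : ((2 : ℕ) : 𝓞 K) ∈ v.asIdeal) (hvbar : ((2 : ℕ) : 𝓞 K) ∈ vbar.asIdeal) (hne : vbar ≠ v)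
    (hι : ∀ (w : InfinitePlace K) (k : 𝓞 K), k ∈ v.asIdeal ↔ ‖ι.symm (w.embedding (k : K))‖ < 1)
    (hframe : FrameData ι v vbar Sθ κ₁ κ₂ γ₁ γ₂ θK⁻¹ l r)
    (hval : MeasureValue ι v vbar Sθ (IsCosetValues ι v vbar) r l (fun z ↦ ‖z‖ ≤ (2 : ℝ) ^ (-(M : ℝ) / 2))) :
    KatzValueUpper₂ ι v vbar Sθ κ₁ κ₂ γ₁ γ₂ θK r M :=
  katzValueUpper₂_of_cut (lMeasureFactWith_cosetValues_of_fact hA hK ι v vbar hv hvbar hne hι) hv hvbar hframe hval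

end AtTwo

end Summit.BirchSwinnertonDyer.BirchSwinnertonDyer.Cruxes.SplitBadTwoLowerHalfOfFacts.CriticG43.Junction

end
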